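import Literature.MathematicalPhysics.QuantumLattice.StrongCouplingSUNGaugeIntegration
import Literature.MathematicalPhysics.QuantumLattice.GrassmannCompositeGaussian
import Literature.MathematicalPhysics.QuantumLattice.GrassmannHermitianSquares
import Literature.LinearAlgebra.Matrix.PfaffianDeterminant
import Literature.LinearAlgebra.Matrix.DetCycleExpansion
import HarnessLib

/-!
# The `β = 0` `SU(N)` partition function (one staggered flavour, `N` odd) as a POSITIVE sum:
# partial dimers times baryon DETERMINANTS (Pfaffian structure of the monomer–dimer–polymer system)

Rossi–Wolff (1984) and Karsch–Mütter (1989) write the `β = 0` lattice gauge theory with staggered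
fermions, after the one-link integrals, as a monomer–dimer(–polymer) system; for `G = SU(N)` the
baryon loops carry signs — Fromm–de Forcrand, arXiv:0811.1931, eq. (6) p. 3: "`Z(m,μ) = ∑_{n_x,n_b,C_B}
∏_b (N_c-n_b)!/(N_c!n_b!) ∏_x N_c!/n_x! (2m)^{n_x} ∏_{C_B} w(C_B)` … `w(C_B,±) = ε(C_B) exp(±3ℓL_tμ)`
where `ε(C_B)` is a sign factor depending on the loop geometry".  This file proves, at `m = 0` and
for odd `N`, an exact resummation in which NO loop sign appears.  By the exponential form of the link
factor (`StrongCoupling.bondFactorSU_eq_exp_add`: `F_b = exp(κ_b b̄(x_b)b(y_b) + κ'_b b̄(y_b)b(x_b)) +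
∑_{j=1}^{N-1} c_j (ψ̄ψ(x_b)ψ̄ψ(y_b))^j`, `c_j = (N-j)!/(N!j!)·4^{-j}`; `bondFactorSU_eq_sum_linkPiece`),
expanding `∏_b F_b` over the PARTIAL dimer numbers `n_b ∈ {0,…,N-1}` (`fermiZSU_zero_eq_sum`,
`prod_linkPieceC_eq`), killing every hop that touches a dimer site (`mesonPowC_mul_hopSU_eq_zero`: the
close-packing constraint) and integrating the Gaussian in the composite — odd, pairwise anticommuting —
baryon fields over the untouched sites `S(n)` (`GrassmannAlgebra.berezin_mul_grassmannExp_composite`,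
`sum_hopSU_untouched_eq`, `berezin_term_eq`), one gets (`fermiZSU_eq_sum_det_red`)

  `Z_{SU(N)} = ∫𝒟ψ̄𝒟ψ𝒟V e^{-S_F} = σ_Λ (N!)^{|Λ|} ∑_{n admissible} [∏_b c_{n_b}] (N!)^{-|S(n)|} det K̃_{S(n)}`,

the sum over `n : links → {0,…,N-1}` such that every site is either SATURATED (`d_n(x) := ∑_{b ∋ x} n_b = N`)
or UNTOUCHED (`d_n(x) = 0`, `x ∈ S(n)`), with `K̃_{S(n)}` the reduced baryon hopping matrix on the untouched
sites (`K̃_{x_b y_b} = (-Γ_b/2)^N`, `K̃_{y_b x_b} = (Γ_b/2)^N`; `Kred`) and `σ_Λ = ±1` the fixed orientation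
sign of the tree's Berezin integral (`fermiZSU_eq_sum_det` is the same statement with the unreduced matrix
`K = ε_N K̃`, `ε_N = (-1)^{N(N-1)/2}`).  More generally, for every MESONIC OBSERVABLE `∏_x (ψ̄ψ(x))^{e(x)}`
(`e : Λ → ℕ`) the same formula holds with the degree pattern `D = d_n + e` in place of `d_n`
(`fermiBracketSU_mesonPow_eq_sum_det`, `fermiBracketSU_mesonPow_eq_sum_det_red`, `berezin_obs_term_eq`):
all the objects below (`Free D`, `Kmat`, `Kred`, `freeFam`, …) are parametrised by a degree pattern
`D : Λ → ℕ`.  Configurations with some `D(x) ∉ {0, N}` vanish by nilpotency or by degree counting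
(`berezin_mul_compositeHom_eq_zero`).  For odd `N` and `Γ_b = ±1` the matrix `K̃` is
real and alternating (`KredR_transpose`), so `det K̃_S = Pf(K̃_S)² ≥ 0` (Cayley; the tree's
`isSquare_det_of_transpose_eq_neg`): EVERY TERM of each of these sums is `≥ 0` (`term_nonneg`,
`sgn_mul_fermiBracketSU_mesonPow_nonneg`, `sgn_mul_fermiZSU_nonneg`) — the signed baryon loops of (6) are
the symmetric differences of the pairs of perfect matchings in `Pf²`, the `N`-fold dimers their overlaps.  (The nearest device in print is
the "fermion bag" resummation of Chandrasekharan–Li, PRD 85 (2012) 091502, for four-fermion models;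
Karsch–Mütter's regrouping, Fromm–de Forcrand (7), achieves nonnegative weights at `μ = 0` loop by loop.)

Finally the MASSIVE partition function is the monomer sum `Z(m) = ∑_e (∏_x m^{e_x}/e_x!) ∫ e^{-S_F}|_{m=0}
∏_x ψ̄ψ(x)^{e_x}` (`fermiZSU_eq_sum_monomer`), so that `σ_Λ Z(m) ≥ 0` for every real `m ≥ 0` and odd `N`
(`sgn_mul_fermiZSU_nonneg_of_nonneg`: no sign problem at `μ = 0`, Fromm–de Forcrand (7)); the same holds
with any mesonic observable inserted (`fermiBracketSU_mesonPow_eq_sum_monomer`,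
`sgn_mul_fermiBracketSU_mesonPow_nonneg_of_nonneg`), whence the GRIFFITHS-TYPE POSITIVITY
`⟨∏_x (ψ̄ψ(x))^{e_x}⟩_{Λ,m} ≥ 0` of all mesonic expectations for odd `N` and `m ≥ 0`
(`fermiExpectSU_mesonPow_nonneg`), and `σ_Λ Z(m) ≥ (m^N)^{|Λ|} > 0` for `m > 0` (`sgn_mul_fermiZSU_pos`,
`fermiZSU_ne_zero_of_pos`: the expectations are genuine quotients at every `m > 0`).  A last section
records the bookkeeping of adding one dimer on a bond (`addDimer`, `siteDeg_addDimer`,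
`prod_dimerCoeff_eq_mul_addDimer`: `w(n) = 4(n_b+1)(N-n_b) w(n+δ_b)`, `sum_filter_one_le_eq_sum_addDimer`),
the re-indexing used when mesonic two-point functions are compared with `Z`, and proves the
SCHWINGER–DYSON LOWER BOUND MODULO THE BARYONIC SITES (`sd_bond_lower_bound`, `sd_site_lower_bound`):
`∑_{b ∋ x} σ_Λ ∫ e^{-S_F} ψ̄ψ(x_b)ψ̄ψ(y_b) ≥ 8N · σ_Λ (Z - Z_S(x))` for odd `N`, where `Z_S(x)` is the part of
`Z` from the configurations leaving `x` untouched by dimers (the baryonic sites) — Salmhofer–Seiler's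
mesonic Schwinger–Dyson bound ((3.44)–(3.46), Lemma 4.7) for `SU(N)` up to the baryon-loop probability at `x`;
the baryon determinant at an untouched site is finally expanded along the baryon loops through it
(`det_Kred_eq_sum_cycle`, from `Literature.LinearAlgebra.Matrix.det_eq_sum_cycle_of_diag_eq_zero`); its
`2`-cycles `(x_b y_b)` are the `N`-fold dimers: `swap_term_eq` (`= 4^{-N} det K̃[S ∖ {x_b,y_b}]`),
`det_submatrix_swap_eq` (the complementary minor is the baryon determinant of the pattern with `x_b, y_b`
saturated), `card_free_saturate`, `dimerCoeff_pred_mul_factorial_sq` (`c_{N-1}(N!)² = 4N·4^{-N}`: the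
`N`-fold-dimer terms of the two-point function are `4N` times the `2`-cycle terms of `Z`); and the
EXACT per-bond Schwinger–Dyson decomposition `sd_bond_eq` / `topDimer_sum_eq` / `sd_bond_eq_topDimer`:
`σ_Λ∫ψ̄ψ(x_b)ψ̄ψ(y_b)e^{-S_F} = (N!)^{|Λ|}[∑_{n adm} 4n_b(N+1-n_b)W(n) + 4N·4^{-N}∑_{n_b=0, adm, x_b,y_b ∈ S(n)} w(n)(N!)^{-|S(n)|} det K̃_{S(n)∖{x_b,y_b}}]`.

Honest framing: `β = 0`, one staggered flavour, `N` odd for the sign statements, any finite set of links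
with distinct endpoints and signs `Γ_b = ±1`, `m ≥ 0` real; identities and termwise sign statements —
nothing about `β > 0`, `μ ≠ 0`, correlation inequalities, chiral symmetry breaking, the thermodynamic
limit or the continuum.

## References

* M. Fromm, Ph. de Forcrand, arXiv:0811.1931, (4)–(7) p. 3. [FrommForcrand2008]
* I. Montvay, G. Münster, *Quantum Fields on a Lattice* (1994), §5.1.4 (5.38)–(5.44). [MontvayMunster1994]
* P. Rossi, U. Wolff, Nucl. Phys. B 248 (1984) 105. [RossiWolff1984]
* M. Salmhofer, E. Seiler, Commun. Math. Phys. 139 (1991) 395, §2. [SalmhoferSeiler1991]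
* F. A. Berezin, *The Method of Second Quantization* (1966), Ch. I §3. [Berezin1966]
* S. Chandrasekharan, A. Li, PRD 85 (2012) 091502, §4. [ChandrasekharanLi2012]
* A. Cayley, J. reine angew. Math. 38 (1849) 93–96; C. D. Godsil, *Algebraic Combinatorics* (1993), Ch. 7 Thm 2.3 (`det = Pf²`). [Cayley1849] [Godsil1993]
-/


noncomputable section

namespace Literature.MathematicalPhysics.QuantumLattice

namespace StrongCoupling

open GrassmannAlgebra Matrix ExteriorAlgebra

section Prelim

variable {Λ : Type*} [LinearOrder Λ] {N : ℕ}

/-! ### Annihilation of baryon products by their own generators; degrees; anticommutation -/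

omit [LinearOrder Λ] in
/-- A generator occurring in an `n`-fold product annihilates it: `ι(v a) · ιMulti v = 0`. [cite: Berezin1966, Ch. I §3 (3.1)] -/
theorem ι_apply_mul_ιMulti {M : Type*} [AddCommGroup M] [Module ℂ M] {n : ℕ} (v : Fin n → M) (a : Fin n) :
    ι ℂ (v a) * ιMulti ℂ n v = 0 := by
  have h : ιMulti ℂ (n + 1) (Fin.cons (v a) v) = ι ℂ (v a) * ιMulti ℂ n v := by
    rw [ιMulti_succ_apply, Fin.cons_zero]
    rfl
  rw [← h]
  exact AlternatingMap.map_eq_zero_of_eq _ (Fin.cons (v a) v) (i := 0) (j := a.succ)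
    (by rw [Fin.cons_zero, Fin.cons_succ]) (Fin.succ_ne_zero a).symm

/-- `b̄(x)` as an `N`-fold product of generators. [cite: MontvayMunster1994, §5.1.4 (5.44)] -/
theorem bbar_eq_ιMulti (x : Λ) :
    (bbar x : FermiAlg Λ N) = ιMulti ℂ N (fun a => (Pi.single (barIdx (cidx x a)) (1 : ℂ) : CIdx Λ N ⊕ₗ CIdx Λ N → ℂ)) := by
  rw [bbar, ιMulti_apply]; rfl

/-- `b(x)` as an `N`-fold product of generators. [cite: MontvayMunster1994, §5.1.4 (5.44)] -/
theorem bar_eq_ιMulti (x : Λ) :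
    (bar x : FermiAlg Λ N) = ιMulti ℂ N (fun a => (Pi.single (psiIdx (cidx x a)) (1 : ℂ) : CIdx Λ N ⊕ₗ CIdx Λ N → ℂ)) := by
  rw [bar, ιMulti_apply]; rfl

/-- **The meson field annihilates the antibaryon at the same site**: `ψ̄ψ(x) · b̄(x) = 0`. [cite: MontvayMunster1994, §5.1.4 (5.44)] -/
theorem meson_mul_bbar (x : Λ) : (meson x : FermiAlg Λ N) * bbar x = 0 := by
  rw [meson, Finset.sum_mul]
  refine Finset.sum_eq_zero fun a _ => ?_
  rw [pair, psiBar, psi, gen, gen, bbar_eq_ιMulti, mul_assoc, ι_mul_ιMulti, mul_smul_comm, ← mul_assoc,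
    ι_apply_mul_ιMulti (fun a => (Pi.single (barIdx (cidx x a)) (1 : ℂ) : CIdx Λ N ⊕ₗ CIdx Λ N → ℂ)) a,
    zero_mul, smul_zero]

/-- **The meson field annihilates the baryon at the same site**: `ψ̄ψ(x) · b(x) = 0`. [cite: MontvayMunster1994, §5.1.4 (5.44)] -/
theorem meson_mul_bar (x : Λ) : (meson x : FermiAlg Λ N) * bar x = 0 := by
  rw [meson, Finset.sum_mul]
  refine Finset.sum_eq_zero fun a _ => ?_
  rw [pair, psiBar, psi, gen, gen, bar_eq_ιMulti, mul_assoc,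
    ι_apply_mul_ιMulti (fun a => (Pi.single (psiIdx (cidx x a)) (1 : ℂ) : CIdx Λ N ⊕ₗ CIdx Λ N → ℂ)) a, mul_zero]

/-- A positive meson power kills both hops of any link at the site: `ψ̄ψ(x)^d · b̄(x)b(y) = 0`, `d ≥ 1`. [cite: MontvayMunster1994, §5.1.4 (5.44)] -/
theorem meson_pow_mul_bbar_mul_bar (x y : Λ) {d : ℕ} (hd : 0 < d) :
    (meson x : FermiAlg Λ N) ^ d * (bbar x * bar y) = 0 := by
  obtain ⟨e, rfl⟩ := Nat.exists_eq_succ_of_ne_zero hd.ne'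
  rw [pow_succ, mul_assoc, ← mul_assoc (meson x), meson_mul_bbar, zero_mul, mul_zero]

/-- `ψ̄ψ(x)^d · b̄(y)b(x) = 0`, `d ≥ 1` (the meson field is central). [cite: MontvayMunster1994, §5.1.4 (5.44)] -/
theorem meson_pow_mul_bbar_mul_bar' (x y : Λ) {d : ℕ} (hd : 0 < d) :
    (meson x : FermiAlg Λ N) ^ d * (bbar y * bar x) = 0 := by
  obtain ⟨e, rfl⟩ := Nat.exists_eq_succ_of_ne_zero hd.ne'
  rw [pow_succ, mul_assoc, ← mul_assoc (meson x), (commute_meson x (bbar y)).eq, mul_assoc, meson_mul_bar,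
    mul_zero, mul_zero]

/-- `b̄(x)` has degree `N`. [cite: Berezin1966, Ch. I §3 (3.3)] -/
theorem bbar_mem_exteriorPower (x : Λ) : (bbar x : FermiAlg Λ N) ∈ ⋀[ℂ]^N (CIdx Λ N ⊕ₗ CIdx Λ N → ℂ) := by
  rw [bbar_eq_ιMulti]
  exact ExteriorAlgebra.ιMulti_range ℂ N (Set.mem_range_self _)

/-- `b(x)` has degree `N`. [cite: Berezin1966, Ch. I §3 (3.3)] -/
theorem bar_mem_exteriorPower (x : Λ) : (bar x : FermiAlg Λ N) ∈ ⋀[ℂ]^N (CIdx Λ N ⊕ₗ CIdx Λ N → ℂ) := by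
  rw [bar_eq_ιMulti]
  exact ExteriorAlgebra.ιMulti_range ℂ N (Set.mem_range_self _)

/-- The meson field has degree `2`. [cite: Berezin1966, Ch. I §3 (3.3)] -/
theorem meson_mem_exteriorPower (x : Λ) : (meson x : FermiAlg Λ N) ∈ ⋀[ℂ]^2 (CIdx Λ N ⊕ₗ CIdx Λ N → ℂ) := by
  refine Submodule.sum_mem _ fun a _ => ?_
  rw [pair, psiBar, psi, show (2 : ℕ) = 1 + 1 from rfl]
  exact mul_mem_exteriorPower (gen_mem_exteriorPower_one _) (gen_mem_exteriorPower_one _)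

/-- `ψ̄ψ(x)^d` has degree `2d`. [cite: Berezin1966, Ch. I §3 (3.3)] -/
theorem meson_pow_mem_exteriorPower (x : Λ) (d : ℕ) :
    (meson x : FermiAlg Λ N) ^ d ∈ ⋀[ℂ]^(2 * d) (CIdx Λ N ⊕ₗ CIdx Λ N → ℂ) := by
  induction d with
  | zero => rw [pow_zero, mul_zero, exteriorPower, pow_zero]; exact Submodule.mem_one.2 ⟨1, map_one _⟩
  | succ d ih => rw [pow_succ, Nat.mul_succ]; exact mul_mem_exteriorPower ih (meson_mem_exteriorPower x)

omit [LinearOrder Λ] in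
/-- Two odd elements anticommute. [cite: Berezin1966, Ch. I §3 (3.1)] -/
theorem odd_mul_odd_add {a y : FermiAlg Λ N} (ha : a ∈ evenOdd ℂ (ι := CIdx Λ N ⊕ₗ CIdx Λ N) 1)
    (hy : y ∈ evenOdd ℂ (ι := CIdx Λ N ⊕ₗ CIdx Λ N) 1) : y * a + a * y = 0 := by
  rw [mul_eq_mul_involute_of_mem_evenOdd_one ha y, CliffordAlgebra.involute_eq_of_mem_odd hy, mul_neg, neg_add_cancel]

/-- For odd `N`, `b̄(x)` is odd. [cite: Berezin1966, Ch. I §3 (3.1)] -/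
theorem bbar_mem_evenOdd_one (hN : Odd N) (x : Λ) : (bbar x : FermiAlg Λ N) ∈ evenOdd ℂ (ι := CIdx Λ N ⊕ₗ CIdx Λ N) 1 := by
  have h := bbar_mem_evenOdd (N := N) x
  rwa [(ZMod.natCast_eq_one_iff_odd).2 hN] at h

/-- For odd `N`, `b(x)` is odd. [cite: Berezin1966, Ch. I §3 (3.1)] -/
theorem bar_mem_evenOdd_one (hN : Odd N) (x : Λ) : (bar x : FermiAlg Λ N) ∈ evenOdd ℂ (ι := CIdx Λ N ⊕ₗ CIdx Λ N) 1 := by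
  have h := bar_mem_evenOdd (N := N) x
  rwa [(ZMod.natCast_eq_one_iff_odd).2 hN] at h

end Prelim

/-! ### The partial-dimer expansion of the effective weight -/

section Expansion

variable {Λ : Type*} [LinearOrder Λ] [Fintype Λ] {N : ℕ}
variable {B : Type*} [Fintype B] [DecidableEq B]

variable (N) in
/-- The forward hop coefficient `κ(Γ) = (-1)^{N(N-1)/2} (-Γ/2)^N` of the staggered `SU(N)` link factor. [cite: FrommForcrand2008, (5)] -/
def kapF (Γ : ℂ) : ℂ := (-1 : ℂ) ^ (N * (N - 1) / 2) * (-(Γ / 2)) ^ N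

variable (N) in
/-- The backward hop coefficient `κ'(Γ) = (-1)^{N(N-1)/2} (Γ/2)^N`. [cite: FrommForcrand2008, (5)] -/
def kapB (Γ : ℂ) : ℂ := (-1 : ℂ) ^ (N * (N - 1) / 2) * (Γ / 2) ^ N

/-- **The baryon hop term of a link**: `κ_b b̄(x_b)b(y_b) + κ'_b b̄(y_b)b(x_b)`. [cite: FrommForcrand2008, (5)] -/
def hopSU (l : B → Λ × Λ) (Γ : B → ℂ) (b : B) : FermiAlg Λ N :=
  kapF N (Γ b) • (bbar (l b).1 * bar (l b).2) + kapB N (Γ b) • (bbar (l b).2 * bar (l b).1)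

variable (N) in
/-- The dimer coefficient `(N-j)!/(N! j!) · 4^{-j}` of `j` dimers on a link (`α_j` of Fromm–de Forcrand
(5)–(6) times the `¼` of Salmhofer–Seiler (2.16)–(2.17)); `= 1` for `j = 0`. [cite: FrommForcrand2008, (5)–(6)] -/
def dimerCoeff (j : ℕ) : ℂ := ((N - j).factorial : ℂ) / ((N.factorial : ℂ) * (j.factorial : ℂ)) * (1 / 4 : ℂ) ^ j

/-- **The `j`-th piece of the `SU(N)` link factor in exponential form**: `j = 0 ↦ exp(hops_b)`,
`1 ≤ j ≤ N-1 ↦ (N-j)!/(N!j!) (¼ ψ̄ψ(x_b)ψ̄ψ(y_b))^j` (the partial dimers). [cite: FrommForcrand2008, (5)–(6)] -/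
def linkPiece (l : B → Λ × Λ) (Γ : B → ℂ) (b : B) (j : Fin N) : FermiAlg Λ N :=
  if (j : ℕ) = 0 then grassmannExp (hopSU l Γ b)
  else dimerCoeff N j • (meson (l b).1 * meson (l b).2) ^ (j : ℕ)

omit [Fintype Λ] [Fintype B] [DecidableEq B] in
/-- The hop term is even. [cite: Berezin1966, Ch. I §3 (3.1)] -/
theorem hopSU_mem_evenOdd_zero (l : B → Λ × Λ) (Γ : B → ℂ) (b : B) :
    (hopSU l Γ b : FermiAlg Λ N) ∈ evenOdd ℂ (ι := CIdx Λ N ⊕ₗ CIdx Λ N) 0 :=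
  Submodule.add_mem _ (Submodule.smul_mem _ _ (bbar_mul_bar_mem_evenOdd_zero _ _))
    (Submodule.smul_mem _ _ (bbar_mul_bar_mem_evenOdd_zero _ _))

omit [Fintype Λ] [Fintype B] [DecidableEq B] in
/-- The baryon products have no constant part (`N ≥ 1`). [cite: MontvayMunster1994, §5.1.4 (5.44)] -/
theorem constPart_bbar_mul_bar (hN : 0 < N) (x y : Λ) : constPart ℂ (bbar x * bar y : FermiAlg Λ N) = 0 := by
  obtain ⟨n, rfl⟩ := Nat.exists_eq_succ_of_ne_zero hN.ne'
  rw [map_mul, bbar, map_list_prod, List.map_ofFn, List.ofFn_succ, List.prod_cons, Function.comp_apply, psiBar,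
    constPart_gen, zero_mul, zero_mul]

omit [Fintype B] [DecidableEq B] in
/-- The hop term is nilpotent (it has no constant part; `N ≥ 1`). [cite: Berezin1966, Ch. I §3 (3.1)] -/
theorem isNilpotent_hopSU (hN : 0 < N) (l : B → Λ × Λ) (Γ : B → ℂ) (b : B) : IsNilpotent (hopSU l Γ b : FermiAlg Λ N) := by
  refine ⟨_, pow_card_succ_eq_zero_of_constPart_eq_zero ℂ ?_⟩
  rw [hopSU, map_add, map_smul, map_smul, constPart_bbar_mul_bar hN, constPart_bbar_mul_bar hN]
  simp

omit [Fintype Λ] [Fintype B] [DecidableEq B] in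
/-- The hop term is central. [cite: Berezin1966, Ch. I §3 (3.1)] -/
theorem commute_hopSU (l : B → Λ × Λ) (Γ : B → ℂ) (b : B) (z : FermiAlg Λ N) : Commute (hopSU l Γ b) z :=
  commute_of_mem_evenOdd_zero ℂ (hopSU_mem_evenOdd_zero l Γ b) z

omit [Fintype B] [DecidableEq B] in
/-- `exp(hops_b)` is central (`N ≥ 1`). [cite: Berezin1966, Ch. I §3 (3.1)] -/
theorem commute_grassmannExp_hopSU (hN : 0 < N) (l : B → Λ × Λ) (Γ : B → ℂ) (b : B) (z : FermiAlg Λ N) :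
    Commute (grassmannExp (hopSU l Γ b)) z :=
  commute_of_mem_evenOdd_zero ℂ
    (grassmannExp_mem_evenOdd_zero ℂ (hopSU_mem_evenOdd_zero l Γ b) (isNilpotent_hopSU hN l Γ b)) z

omit [Fintype B] [DecidableEq B] in
/-- Every piece of the link factor is central (`N ≥ 1`). [cite: FrommForcrand2008, (5)–(6)] -/
theorem commute_linkPiece (hN : 0 < N) (l : B → Λ × Λ) (Γ : B → ℂ) (b : B) (j : Fin N) (z : FermiAlg Λ N) :
    Commute (linkPiece l Γ b j) z := by
  unfold linkPiece
  split_ifs with h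
  · exact commute_grassmannExp_hopSU hN l Γ b z
  · exact (((commute_meson _ z).mul_left (commute_meson _ z)).pow_left _).smul_left _

omit [Fintype B] [DecidableEq B] in
/-- **The `SU(N)` link factor as the sum of its pieces** (`N ≥ 1`, `x_b ≠ y_b`, `Γ_b² = 1`):
`F_b = ∑_{j=0}^{N-1} (piece j)`. [cite: FrommForcrand2008, (5)–(6)] -/
theorem bondFactorSU_eq_sum_linkPiece (hN : 0 < N) {l : B → Λ × Λ} (hl : ∀ b, (l b).1 ≠ (l b).2) {Γ : B → ℂ}
    (hΓ : ∀ b, Γ b ^ 2 = 1) (b : B) :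
    (bondFactorSU (l b).1 (l b).2 (Γ b) : FermiAlg Λ N) = ∑ j : Fin N, linkPiece l Γ b j := by
  have hsum : ∑ j : Fin N, linkPiece l Γ b j = ∑ j ∈ Finset.range N,
      (if j = 0 then grassmannExp (hopSU l Γ b) else dimerCoeff N j • (meson (l b).1 * meson (l b).2 : FermiAlg Λ N) ^ j) :=
    Fin.sum_univ_eq_sum_range (fun j => if j = 0 then grassmannExp (hopSU l Γ b)
      else dimerCoeff N j • (meson (l b).1 * meson (l b).2 : FermiAlg Λ N) ^ j) N
  rw [hsum, bondFactorSU_eq_exp_add (hl b) hN (Γ b) (hΓ b), Finset.range_eq_Ico, Finset.sum_eq_sum_Ico_succ_bot hN,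
    if_pos rfl]
  congr 1
  refine Finset.sum_congr rfl fun j hj => ?_
  have hj0 : j ≠ 0 := by have := (Finset.mem_Ico.1 hj).1; omega
  rw [if_neg hj0, _root_.smul_pow, smul_smul, dimerCoeff]


/-! ### Stage B2: `Z = ∑_n ∫ ∏_b (piece_b (n_b))` -/

/-- The exponential of the hop term as a central element (`N ≥ 1`). [cite: FrommForcrand2008, (5)] -/
def hopExpC (hN : 0 < N) (l : B → Λ × Λ) (Γ : B → ℂ) (b : B) : Subalgebra.center ℂ (FermiAlg Λ N) :=
  ⟨grassmannExp (hopSU l Γ b), Subalgebra.mem_center_iff.2 fun z => (commute_grassmannExp_hopSU hN l Γ b z).eq.symm⟩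

/-- The pieces of the link factor as central elements (`N ≥ 1`). [cite: FrommForcrand2008, (5)–(6)] -/
def linkPieceC (hN : 0 < N) (l : B → Λ × Λ) (Γ : B → ℂ) (b : B) (j : Fin N) : Subalgebra.center ℂ (FermiAlg Λ N) :=
  if (j : ℕ) = 0 then hopExpC hN l Γ b
  else dimerCoeff N j • (mesonC 1 (l b).1 * mesonC 1 (l b).2) ^ (j : ℕ)

omit [Fintype B] [DecidableEq B] in
/-- The value of `linkPieceC`. [cite: FrommForcrand2008, (5)–(6)] -/
theorem coe_linkPieceC (hN : 0 < N) (l : B → Λ × Λ) (Γ : B → ℂ) (b : B) (j : Fin N) :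
    ((linkPieceC hN l Γ b j : Subalgebra.center ℂ (FermiAlg Λ N)) : FermiAlg Λ N) = linkPiece l Γ b j := by
  unfold linkPieceC linkPiece
  split_ifs with h
  · rfl
  · rw [Subalgebra.coe_smul, Subalgebra.coe_pow, Subalgebra.coe_mul, coe_mesonC, coe_mesonC, one_smul, one_smul]

omit [LinearOrder Λ] [Fintype Λ] in
/-- Products in the centre are ordered products in the algebra (finset version). [cite: SalmhoferSeiler1991, §2 (2.21)] -/
theorem coe_finset_prod_center {α : Type*} [DecidableEq α] (s : Finset α) (f : α → Subalgebra.center ℂ (FermiAlg Λ N)) :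
    ((∏ i ∈ s, f i : Subalgebra.center ℂ (FermiAlg Λ N)) : FermiAlg Λ N) =
      s.noncommProd (fun i => (f i : FermiAlg Λ N))
        (fun i _ j _ _ => (Subalgebra.mem_center_iff.1 (f i).2 (f j : FermiAlg Λ N)).symm) := by
  rw [← Finset.noncommProd_eq_prod]
  exact Finset.map_noncommProd s f _ (Subalgebra.center ℂ (FermiAlg Λ N)).val

/-- **The partial-dimer expansion of the effective Boltzmann weight** at `m = 0` (`N ≥ 1`, distinct
endpoints, `Γ_b² = 1`): `∫𝒟V e^{-S_F} = ∑_{n : links → {0,…,N-1}} ∏_b piece_b(n_b)`. [cite: FrommForcrand2008, (5)–(6)] -/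
theorem gaugeAverageSU_zero_eq_sum (hN : 0 < N) (l : B → Λ × Λ) (hl : ∀ b, (l b).1 ≠ (l b).2) (Γ : B → ℂ)
    (hΓ : ∀ b, Γ b ^ 2 = 1) :
    (gaugeAverageSU l Γ 0 : FermiAlg Λ N) =
      ∑ n : B → Fin N, ((∏ b, linkPieceC hN l Γ b (n b) : Subalgebra.center ℂ (FermiAlg Λ N)) : FermiAlg Λ N) := by
  rw [gaugeAverageSU_eq hN l hl Γ hΓ 0]
  have h1 : Finset.univ.noncommProd (fun x => grassmannExp ((0 : ℂ) • (meson x : FermiAlg Λ N)))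
      (fun x _ _ _ _ => commute_grassmannExp_smul_meson 0 x _) = 1 := by
    rw [Finset.noncommProd_eq_pow_card _ _ _ 1 fun x _ => by rw [zero_smul, grassmannExp, IsNilpotent.exp_zero],
      one_pow]
  have h2 : Finset.univ.noncommProd (fun b => (bondFactorSU (l b).1 (l b).2 (Γ b) : FermiAlg Λ N))
      (fun _ _ _ _ _ => commute_bondFactorSU _ _ _ _) =
      ((∏ b, ∑ j : Fin N, linkPieceC hN l Γ b j : Subalgebra.center ℂ (FermiAlg Λ N)) : FermiAlg Λ N) := by
    rw [coe_prod_center]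
    refine Finset.noncommProd_congr rfl (fun b _ => ?_) _
    rw [bondFactorSU_eq_sum_linkPiece hN hl hΓ b, AddSubmonoidClass.coe_finsetSum]
    exact Finset.sum_congr rfl fun j _ => (coe_linkPieceC hN l Γ b j).symm
  rw [h1, one_mul, h2, Fintype.prod_sum, AddSubmonoidClass.coe_finsetSum]

/-- **`Z_{SU(N)}(m = 0) = ∑_n ∫𝒟ψ̄𝒟ψ ∏_b piece_b(n_b)`**. [cite: FrommForcrand2008, (4)–(6)] -/
theorem fermiZSU_zero_eq_sum (hN : 0 < N) (l : B → Λ × Λ) (hl : ∀ b, (l b).1 ≠ (l b).2) (Γ : B → ℂ)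
    (hΓ : ∀ b, Γ b ^ 2 = 1) :
    fermiZSU (N := N) l Γ 0 =
      ∑ n : B → Fin N, berezin ℂ _ (((∏ b, linkPieceC hN l Γ b (n b) : Subalgebra.center ℂ (FermiAlg Λ N))) : FermiAlg Λ N) := by
  rw [fermiZSU, fermiBracketSU_const l hl Γ 0 1, one_mul, gaugeAverageSU_zero_eq_sum hN l hl Γ hΓ, map_sum]

/-! ### Stage B2': the term of a partial-dimer configuration -/

/-- **The site degree** `d_n(x) = ∑_{b ∋ x} n_b` of a partial-dimer configuration. [cite: FrommForcrand2008, (6)] -/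
def siteDeg (l : B → Λ × Λ) (n : B → Fin N) (x : Λ) : ℕ :=
  (∑ b ∈ Finset.univ.filter (fun b => (l b).1 = x), (n b : ℕ)) +
    ∑ b ∈ Finset.univ.filter (fun b => (l b).2 = x), (n b : ℕ)

omit [Fintype Λ] [DecidableEq B] in
/-- A link's dimer number is at most the degree of its first endpoint. [cite: FrommForcrand2008, (6)] -/
theorem le_siteDeg_fst (l : B → Λ × Λ) (n : B → Fin N) (b : B) : (n b : ℕ) ≤ siteDeg l n (l b).1 := by
  refine le_trans ?_ (Nat.le_add_right _ _)
  exact Finset.single_le_sum (f := fun b => (n b : ℕ)) (fun _ _ => Nat.zero_le _)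
    (Finset.mem_filter.2 ⟨Finset.mem_univ _, rfl⟩)

omit [Fintype Λ] [DecidableEq B] in
/-- A link's dimer number is at most the degree of its second endpoint. [cite: FrommForcrand2008, (6)] -/
theorem le_siteDeg_snd (l : B → Λ × Λ) (n : B → Fin N) (b : B) : (n b : ℕ) ≤ siteDeg l n (l b).2 := by
  refine le_trans ?_ (Nat.le_add_left _ _)
  exact Finset.single_le_sum (f := fun b => (n b : ℕ)) (fun _ _ => Nat.zero_le _)
    (Finset.mem_filter.2 ⟨Finset.mem_univ _, rfl⟩)

/-- `dimerCoeff N 0 = 1`. [cite: FrommForcrand2008, (5)] -/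
theorem dimerCoeff_zero : dimerCoeff N 0 = 1 := by
  rw [dimerCoeff, Nat.sub_zero, Nat.factorial_zero, Nat.cast_one, mul_one, pow_zero, mul_one,
    div_self (Nat.cast_ne_zero.2 (Nat.factorial_ne_zero N))]

/-- A product of meson powers `∏_x (ψ̄ψ(x))^{D(x)}` in the centre (`D = d_n` for a bare term,
`D = d_n + e` with a mesonic observable `∏_x (ψ̄ψ(x))^{e(x)}` inserted). [cite: FrommForcrand2008, (6)] -/
def mesonPowD (D : Λ → ℕ) : Subalgebra.center ℂ (FermiAlg Λ N) :=
  ∏ x, mesonC 1 x ^ D x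

omit [DecidableEq B] in
/-- Regrouping the dimers by site: `∏_b (ψ̄ψ(x_b) ψ̄ψ(y_b))^{n_b} = ∏_x ψ̄ψ(x)^{d_n(x)}`. [cite: FrommForcrand2008, (6)] -/
theorem prod_mesonC_mul_pow_eq (l : B → Λ × Λ) (n : B → Fin N) :
    (∏ b, (mesonC 1 (l b).1 * mesonC 1 (l b).2) ^ (n b : ℕ) : Subalgebra.center ℂ (FermiAlg Λ N)) =
      mesonPowD (siteDeg l n) := by
  simp only [mul_pow, Finset.prod_mul_distrib, mesonPowD, siteDeg, pow_add]
  congr 1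
  · rw [← Finset.prod_fiberwise Finset.univ (fun b => (l b).1) (fun b => mesonC (N := N) 1 (l b).1 ^ (n b : ℕ))]
    refine Finset.prod_congr rfl fun x _ => ?_
    rw [← Finset.prod_pow_eq_pow_sum]
    exact Finset.prod_congr rfl fun b hb => by rw [(Finset.mem_filter.1 hb).2]
  · rw [← Finset.prod_fiberwise Finset.univ (fun b => (l b).2) (fun b => mesonC (N := N) 1 (l b).2 ^ (n b : ℕ))]
    refine Finset.prod_congr rfl fun x _ => ?_
    rw [← Finset.prod_pow_eq_pow_sum]
    exact Finset.prod_congr rfl fun b hb => by rw [(Finset.mem_filter.1 hb).2]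

omit [DecidableEq B] in
/-- **The term of a configuration**: `∏_b piece_b(n_b) = (∏_b c_{n_b}) · ∏_x ψ̄ψ(x)^{d_n(x)} · ∏_{b : n_b = 0} exp(hops_b)`. [cite: FrommForcrand2008, (5)–(6)] -/
theorem prod_linkPieceC_eq (hN : 0 < N) (l : B → Λ × Λ) (Γ : B → ℂ) (n : B → Fin N) :
    (∏ b, linkPieceC hN l Γ b (n b) : Subalgebra.center ℂ (FermiAlg Λ N)) =
      (∏ b, dimerCoeff N (n b)) •
        (mesonPowD (siteDeg l n) * ∏ b ∈ Finset.univ.filter (fun b => (n b : ℕ) = 0), hopExpC hN l Γ b) := by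
  rw [← Finset.prod_filter_mul_prod_filter_not Finset.univ (fun b => (n b : ℕ) = 0)]
  have hA : ∏ b ∈ Finset.univ.filter (fun b => (n b : ℕ) = 0), linkPieceC hN l Γ b (n b) =
      ∏ b ∈ Finset.univ.filter (fun b => (n b : ℕ) = 0), hopExpC hN l Γ b :=
    Finset.prod_congr rfl fun b hb => by rw [linkPieceC, if_pos (Finset.mem_filter.1 hb).2]
  have hB : ∏ b ∈ Finset.univ.filter (fun b => ¬(n b : ℕ) = 0), linkPieceC hN l Γ b (n b) =
      ∏ b ∈ Finset.univ.filter (fun b => ¬(n b : ℕ) = 0),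
        dimerCoeff N (n b) • (mesonC 1 (l b).1 * mesonC 1 (l b).2) ^ (n b : ℕ) :=
    Finset.prod_congr rfl fun b hb => by rw [linkPieceC, if_neg (Finset.mem_filter.1 hb).2]
  have hC : ∏ b ∈ Finset.univ.filter (fun b => ¬(n b : ℕ) = 0), dimerCoeff N (n b) = ∏ b, dimerCoeff N (n b) :=
    Finset.prod_filter_of_ne fun b _ hb h0 => hb (by rw [h0, dimerCoeff_zero])
  have hD : ∏ b ∈ Finset.univ.filter (fun b => ¬(n b : ℕ) = 0),
      ((mesonC 1 (l b).1 * mesonC 1 (l b).2) ^ (n b : ℕ) : Subalgebra.center ℂ (FermiAlg Λ N)) =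
      ∏ b, (mesonC 1 (l b).1 * mesonC 1 (l b).2) ^ (n b : ℕ) :=
    Finset.prod_filter_of_ne fun b _ hb h0 => hb (by rw [h0, pow_zero])
  rw [hA, hB, Finset.prod_smul, hC, hD, prod_mesonC_mul_pow_eq, mul_smul_comm, mul_comm]

end Expansion

/-! ### Stage B3: hops touching a dimer site drop out; the surviving hops as a quadratic form -/

section Killing

variable {Λ : Type*} [LinearOrder Λ] [Fintype Λ] {N : ℕ}
variable {B : Type*} [Fintype B] [DecidableEq B]

omit [DecidableEq B] in
/-- Splitting off one site from the meson powers. [cite: FrommForcrand2008, (6)] -/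
theorem coe_mesonPowD_eq_mul (D : Λ → ℕ) (x : Λ) :
    ((mesonPowD D : Subalgebra.center ℂ (FermiAlg Λ N)) : FermiAlg Λ N) =
      ((∏ y ∈ Finset.univ.erase x, mesonC 1 y ^ D y : Subalgebra.center ℂ (FermiAlg Λ N)) : FermiAlg Λ N) *
        (meson x : FermiAlg Λ N) ^ D x := by
  rw [mesonPowD, ← Finset.prod_erase_mul Finset.univ _ (Finset.mem_univ x), Subalgebra.coe_mul, Subalgebra.coe_pow,
    coe_mesonC, one_smul]

omit [Fintype B] [DecidableEq B] in
/-- **A hop on a link touching a dimer site dies**: `∏_x ψ̄ψ(x)^{d_n(x)} · hops_b = 0` if `d_n(x_b) ≠ 0`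
or `d_n(y_b) ≠ 0` (the close-packing constraint: baryon loops avoid dimer sites). [cite: FrommForcrand2008, §2 p. 3] -/
theorem mesonPowD_mul_hopSU_eq_zero (l : B → Λ × Λ) (Γ : B → ℂ) (D : Λ → ℕ) (b : B)
    (h : D (l b).1 ≠ 0 ∨ D (l b).2 ≠ 0) :
    ((mesonPowD D : Subalgebra.center ℂ (FermiAlg Λ N)) : FermiAlg Λ N) * hopSU l Γ b = 0 := by
  rcases h with h | h
  · rw [coe_mesonPowD_eq_mul D (l b).1, mul_assoc, hopSU, mul_add, mul_smul_comm, mul_smul_comm,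
      meson_pow_mul_bbar_mul_bar _ _ (Nat.pos_of_ne_zero h), meson_pow_mul_bbar_mul_bar' _ _ (Nat.pos_of_ne_zero h),
      smul_zero, smul_zero, add_zero, mul_zero]
  · rw [coe_mesonPowD_eq_mul D (l b).2, mul_assoc, hopSU, mul_add, mul_smul_comm, mul_smul_comm,
      meson_pow_mul_bbar_mul_bar' _ _ (Nat.pos_of_ne_zero h), meson_pow_mul_bbar_mul_bar _ _ (Nat.pos_of_ne_zero h),
      smul_zero, smul_zero, add_zero, mul_zero]

omit [LinearOrder Λ] [Fintype Λ] [Fintype B] [DecidableEq B] in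
/-- `P · exp(A) = P` when `P · A = 0` (`A` nilpotent). [cite: Berezin1966, Ch. I §3 (3.1)] -/
theorem mul_grassmannExp_eq_self_of_mul_eq_zero {P A : FermiAlg Λ N} (hPA : P * A = 0) (hA : IsNilpotent A) :
    P * grassmannExp A = P := by
  obtain ⟨k, hk⟩ := hA
  have hk' : A ^ (k + 1) = 0 := by rw [pow_succ, hk, zero_mul]
  rw [grassmannExp_eq_sum hk', Finset.mul_sum, Finset.sum_range_succ', pow_zero, Nat.factorial_zero, Nat.cast_one,
    inv_one, one_smul, mul_one, Finset.sum_eq_zero fun i _ => ?_, zero_add]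
  rw [mul_smul_comm, pow_succ', ← mul_assoc, hPA, zero_mul, smul_zero]

omit [Fintype B] [DecidableEq B] in
/-- **Only hops between untouched sites survive** against the meson powers. [cite: FrommForcrand2008, §2 p. 3] -/
theorem mesonPowD_mul_grassmannExp_sum_hopSU (hN : 0 < N) (l : B → Λ × Λ) (Γ : B → ℂ) (D : Λ → ℕ) (s : Finset B) :
    ((mesonPowD D : Subalgebra.center ℂ (FermiAlg Λ N)) : FermiAlg Λ N) * grassmannExp (∑ b ∈ s, hopSU l Γ b) =
      ((mesonPowD D : Subalgebra.center ℂ (FermiAlg Λ N)) : FermiAlg Λ N) *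
        grassmannExp (∑ b ∈ s.filter (fun b => D (l b).1 = 0 ∧ D (l b).2 = 0), hopSU l Γ b) := by
  have hnil : ∀ t : Finset B, IsNilpotent (∑ b ∈ t, (hopSU l Γ b : FermiAlg Λ N)) := fun t =>
    isNilpotent_sum_of_mem_evenOdd_zero t (hopSU_mem_evenOdd_zero l Γ) (isNilpotent_hopSU hN l Γ)
  have hP0 : ((mesonPowD D : Subalgebra.center ℂ (FermiAlg Λ N)) : FermiAlg Λ N) *
      ∑ b ∈ s.filter (fun b => ¬(D (l b).1 = 0 ∧ D (l b).2 = 0)), hopSU l Γ b = 0 := by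
    rw [Finset.mul_sum]
    exact Finset.sum_eq_zero fun b hb => mesonPowD_mul_hopSU_eq_zero l Γ D b (not_and_or.1 (Finset.mem_filter.1 hb).2)
  conv_lhs => rw [← Finset.sum_filter_add_sum_filter_not s
    (fun b => D (l b).1 = 0 ∧ D (l b).2 = 0), add_comm,
    grassmannExp_add_of_mem_evenOdd_zero (sum_mem_evenOdd_zero _ (hopSU_mem_evenOdd_zero l Γ)) (hnil _) (hnil _),
    ← mul_assoc, mul_grassmannExp_eq_self_of_mul_eq_zero hP0 (hnil _)]

omit [Fintype Λ] [DecidableEq B] in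
/-- Links between untouched sites carry no dimers. [cite: FrommForcrand2008, §2 p. 3] -/
theorem filter_filter_untouched (l : B → Λ × Λ) (n : B → Fin N) (D : Λ → ℕ) (hD : ∀ x, siteDeg l n x ≤ D x) :
    (Finset.univ.filter (fun b => (n b : ℕ) = 0)).filter (fun b => D (l b).1 = 0 ∧ D (l b).2 = 0) =
      Finset.univ.filter (fun b => D (l b).1 = 0 ∧ D (l b).2 = 0) := by
  ext b
  simp only [Finset.mem_filter, Finset.mem_univ, true_and, and_iff_right_iff_imp]
  intro h
  exact Nat.eq_zero_of_le_zero ((le_siteDeg_fst l n b).trans (h.1 ▸ hD (l b).1))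

/-- **The untouched sites** `S_D = {x : D(x) = 0}` of a degree pattern (`D = d_n`: the sites carrying no
dimer of the configuration `n`). [cite: FrommForcrand2008, (6)] -/
abbrev Free (D : Λ → ℕ) : Type _ := {x : Λ // D x = 0}

variable (N) in
/-- **The baryon hopping matrix** on the untouched sites: `K_{x_b y_b} = κ_b`, `K_{y_b x_b} = κ'_b`
(summed over parallel links). [cite: FrommForcrand2008, (5)–(6)] -/
def Kmat (l : B → Λ × Λ) (Γ : B → ℂ) (D : Λ → ℕ) : Matrix (Free D) (Free D) ℂ := fun u v =>
  ∑ b, ((if (l b).1 = u.1 ∧ (l b).2 = v.1 then kapF N (Γ b) else 0) +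
    (if (l b).1 = v.1 ∧ (l b).2 = u.1 then kapB N (Γ b) else 0))

variable (N) in
/-- The composite family `(b̄(u))_{u ∈ S} ⊔ (b(u))_{u ∈ S}` on the untouched sites. [cite: MontvayMunster1994, §5.1.4 (5.44)] -/
def freeFam (D : Λ → ℕ) : Free D ⊕ₗ Free D → FermiAlg Λ N := fun i =>
  Sum.elim (fun u : Free D => (bbar u.1 : FermiAlg Λ N)) (fun u => bar u.1) (ofLex i)

omit [Fintype Λ] [DecidableEq B] in
/-- The `inl` components are the antibaryons. [cite: MontvayMunster1994, §5.1.4 (5.44)] -/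
@[simp] theorem freeFam_inl (D : Λ → ℕ) (u : Free D) :
    freeFam N D (toLex (Sum.inl u)) = (bbar u.1 : FermiAlg Λ N) := rfl

omit [Fintype Λ] [DecidableEq B] in
/-- The `inr` components are the baryons. [cite: MontvayMunster1994, §5.1.4 (5.44)] -/
@[simp] theorem freeFam_inr (D : Λ → ℕ) (u : Free D) :
    freeFam N D (toLex (Sum.inr u)) = (bar u.1 : FermiAlg Λ N) := rfl

omit [DecidableEq B] in
/-- Localisation of a double sum over untouched sites (forward pattern). [cite: FrommForcrand2008, (6)] -/
theorem sum_sum_ite_smul_fwd (D : Λ → ℕ) (x y : Λ) (c : ℂ) (h : Λ → Λ → FermiAlg Λ N) :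
    (∑ u : Free D, ∑ v : Free D, (if x = u.1 ∧ y = v.1 then c else 0) • h u.1 v.1) =
      if D x = 0 ∧ D y = 0 then c • h x y else 0 := by
  split_ifs with hxy
  · rw [Fintype.sum_eq_single (⟨x, hxy.1⟩ : Free D) fun u hu => Finset.sum_eq_zero fun v _ => by
        rw [if_neg fun h' => hu (Subtype.ext h'.1.symm), zero_smul],
      Fintype.sum_eq_single (⟨y, hxy.2⟩ : Free D) fun v hv => by
        rw [if_neg fun h' => hv (Subtype.ext h'.2.symm), zero_smul],
      if_pos ⟨rfl, rfl⟩]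
  · exact Finset.sum_eq_zero fun u _ => Finset.sum_eq_zero fun v _ => by
      rw [if_neg fun h' => hxy ⟨by rw [h'.1]; exact u.2, by rw [h'.2]; exact v.2⟩, zero_smul]

omit [DecidableEq B] in
/-- Localisation of a double sum over untouched sites (backward pattern). [cite: FrommForcrand2008, (6)] -/
theorem sum_sum_ite_smul_bwd (D : Λ → ℕ) (x y : Λ) (c : ℂ) (h : Λ → Λ → FermiAlg Λ N) :
    (∑ u : Free D, ∑ v : Free D, (if x = v.1 ∧ y = u.1 then c else 0) • h u.1 v.1) =
      if D x = 0 ∧ D y = 0 then c • h y x else 0 := by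
  split_ifs with hxy
  · rw [Fintype.sum_eq_single (⟨y, hxy.2⟩ : Free D) fun u hu => Finset.sum_eq_zero fun v _ => by
        rw [if_neg fun h' => hu (Subtype.ext h'.2.symm), zero_smul],
      Fintype.sum_eq_single (⟨x, hxy.1⟩ : Free D) fun v hv => by
        rw [if_neg fun h' => hv (Subtype.ext h'.1.symm), zero_smul],
      if_pos ⟨rfl, rfl⟩]
  · exact Finset.sum_eq_zero fun u _ => Finset.sum_eq_zero fun v _ => by
      rw [if_neg fun h' => hxy ⟨by rw [h'.1]; exact v.2, by rw [h'.2]; exact u.2⟩, zero_smul]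

omit [DecidableEq B] in
/-- **The surviving hops are the quadratic form of `K`** in the composite fields:
`∑_{b ⊂ S} hops_b = ∑_{u,v ∈ S} K_{uv} b̄(u) b(v)`. [cite: FrommForcrand2008, (5)–(6)] -/
theorem sum_hopSU_untouched_eq (l : B → Λ × Λ) (Γ : B → ℂ) (D : Λ → ℕ) :
    ∑ b ∈ Finset.univ.filter (fun b => D (l b).1 = 0 ∧ D (l b).2 = 0), (hopSU l Γ b : FermiAlg Λ N) =
      ∑ u : Free D, ∑ v : Free D,
        Kmat N l Γ D u v • (freeFam N D (toLex (Sum.inl u)) * freeFam N D (toLex (Sum.inr v))) := by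
  have hR : ∀ u : Free D, ∑ v : Free D,
      Kmat N l Γ D u v • (freeFam N D (toLex (Sum.inl u)) * freeFam N D (toLex (Sum.inr v))) =
      ∑ b, ∑ v : Free D,
        ((if (l b).1 = u.1 ∧ (l b).2 = v.1 then kapF N (Γ b) else 0) • (bbar u.1 * bar v.1 : FermiAlg Λ N) +
          (if (l b).1 = v.1 ∧ (l b).2 = u.1 then kapB N (Γ b) else 0) • (bbar u.1 * bar v.1 : FermiAlg Λ N)) := by
    intro u
    have hv : ∀ v : Free D,
        Kmat N l Γ D u v • (freeFam N D (toLex (Sum.inl u)) * freeFam N D (toLex (Sum.inr v))) =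
        ∑ b, ((if (l b).1 = u.1 ∧ (l b).2 = v.1 then kapF N (Γ b) else 0) • (bbar u.1 * bar v.1 : FermiAlg Λ N) +
          (if (l b).1 = v.1 ∧ (l b).2 = u.1 then kapB N (Γ b) else 0) • (bbar u.1 * bar v.1 : FermiAlg Λ N)) := by
      intro v
      rw [freeFam_inl, freeFam_inr, Kmat, Finset.sum_smul]
      exact Finset.sum_congr rfl fun b _ => add_smul _ _ _
    rw [Finset.sum_congr rfl fun v _ => hv v, Finset.sum_comm]
  rw [Finset.sum_congr rfl fun u _ => hR u, Finset.sum_comm, Finset.sum_filter]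
  refine Finset.sum_congr rfl fun b _ => ?_
  rw [Finset.sum_congr rfl fun u _ => Finset.sum_add_distrib, Finset.sum_add_distrib,
    sum_sum_ite_smul_fwd D (l b).1 (l b).2 (kapF N (Γ b)) fun a c => (bbar a * bar c : FermiAlg Λ N),
    sum_sum_ite_smul_bwd D (l b).1 (l b).2 (kapB N (Γ b)) fun a c => (bbar a * bar c : FermiAlg Λ N)]
  split_ifs with hb
  · rw [hopSU]
  · rw [add_zero]

end Killing

/-! ### Stage B4a: the composite family, degrees, the top monomial -/

section TopPower

variable {Λ : Type*} [LinearOrder Λ] {N : ℕ}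

/-- `(a + b)^{m+1} = b^{m+1} + (m+1) a b^m` when `a² = 0` and `a` commutes with `b`. [folklore] -/
private theorem add_pow_succ_of_mul_self_eq_zero {A : Type*} [Ring A] {a b : A} (hab : Commute a b) (ha : a * a = 0)
    (m : ℕ) : (a + b) ^ (m + 1) = b ^ (m + 1) + ((m + 1 : ℕ) : A) * (a * b ^ m) := by
  induction m with
  | zero => simp only [zero_add, pow_one, Nat.cast_one, one_mul, pow_zero, mul_one]; exact add_comm a b
  | succ m ih =>
    have hba : b * a = a * b := hab.eq.symm
    have h1 : a * (((m + 1 : ℕ) : A) * (a * b ^ m)) = 0 := by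
      rw [← mul_assoc, ← Nat.cast_comm, mul_assoc, ← mul_assoc a a, ha, zero_mul, mul_zero]
    have h2 : b * (((m + 1 : ℕ) : A) * (a * b ^ m)) = ((m + 1 : ℕ) : A) * (a * b ^ (m + 1)) := by
      rw [← mul_assoc, ← Nat.cast_comm, mul_assoc, ← mul_assoc b a, hba, mul_assoc, ← pow_succ']
    rw [pow_succ', ih, mul_add, add_mul, add_mul, h1, h2, zero_add, ← pow_succ']
    have hc : ((m + 1 + 1 : ℕ) : A) = ((m + 1 : ℕ) : A) + 1 := by simp only [Nat.cast_add, Nat.cast_one]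
    rw [hc, add_mul, one_mul]
    abel

/-- `(∑_a x_a)^n = n! · x₀ ⋯ x_{n-1}` and `(∑_a x_a)^{n+1} = 0` for commuting square-zero `x_a`. [folklore] -/
private theorem sum_pow_card_and_succ {A : Type*} [Ring A] :
    ∀ (n : ℕ) (x : Fin n → A), (∀ i j, Commute (x i) (x j)) → (∀ i, x i * x i = 0) →
      (∑ i, x i) ^ n = ((n.factorial : ℕ) : A) * (List.ofFn x).prod ∧ (∑ i, x i) ^ (n + 1) = 0 := by
  intro n
  induction n with
  | zero => intro x _ _; simp
  | succ n ih =>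
    intro x hc hsq
    have hcomm : Commute (x 0) (∑ i : Fin n, x i.succ) := Commute.sum_right _ _ _ fun i _ => hc 0 i.succ
    obtain ⟨ih1, ih2⟩ := ih (fun i => x i.succ) (fun i j => hc i.succ j.succ) fun i => hsq i.succ
    refine ⟨?_, ?_⟩
    · rw [Fin.sum_univ_succ, add_pow_succ_of_mul_self_eq_zero hcomm (hsq 0) n, ih2, zero_add, ih1,
        List.ofFn_succ, List.prod_cons, ← mul_assoc (x 0), ← Nat.cast_comm, mul_assoc, ← mul_assoc,
        ← Nat.cast_mul, ← Nat.factorial_succ]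
    · rw [Fin.sum_univ_succ, add_pow_succ_of_mul_self_eq_zero hcomm (hsq 0) (n + 1), ih2, mul_zero,
        mul_zero, add_zero, pow_succ, ih2, zero_mul]

/-- **The top meson power at a lattice site is the baryon–antibaryon product**:
`(ψ̄ψ(x))^N = N! ε_N · b̄(x) b(x)`. [cite: MontvayMunster1994, §5.1.4 (5.44)] -/
theorem meson_pow_card_eq_smul (x : Λ) :
    (meson x : FermiAlg Λ N) ^ N = ((N.factorial : ℂ) * sgn N) • (bbar x * bar x : FermiAlg Λ N) := by
  have h := (sum_pow_card_and_succ N (fun a => (pair (cidx x a) (cidx x a) : FermiAlg Λ N))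
    (fun i j => commute_pair _ _ _) (fun i => pair_mul_self _)).1
  have hp : (List.ofFn fun a => (pair (cidx x a) (cidx x a) : FermiAlg Λ N)).prod =
      (List.ofFn fun a => ι ℂ (Pi.single (barIdx (cidx x a)) (1 : ℂ) : CIdx Λ N ⊕ₗ CIdx Λ N → ℂ) *
        ι ℂ (Pi.single (psiIdx (cidx x a)) (1 : ℂ) : CIdx Λ N ⊕ₗ CIdx Λ N → ℂ)).prod := rfl
  have hm : (meson x : FermiAlg Λ N) ^ N = ((N.factorial : ℕ) : FermiAlg Λ N) *
      (List.ofFn fun a => (pair (cidx x a) (cidx x a) : FermiAlg Λ N)).prod := h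
  rw [hm, hp, prod_ι_mul_ι, Finset.sum_range_id, ← bbar_eq_ιMulti, ← bar_eq_ιMulti, mul_smul_comm, ← nsmul_eq_mul,
    ← Nat.cast_smul_eq_nsmul ℂ, smul_smul, sgn_eq, mul_comm]

/-- `b̄(x) b(x) = (N! ε_N)⁻¹ (ψ̄ψ(x))^N`. [cite: MontvayMunster1994, §5.1.4 (5.44)] -/
theorem bbar_mul_bar_eq_smul (x : Λ) :
    (bbar x * bar x : FermiAlg Λ N) = ((N.factorial : ℂ) * sgn N)⁻¹ • (meson x : FermiAlg Λ N) ^ N := by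
  rw [meson_pow_card_eq_smul, inv_smul_smul₀ (mul_ne_zero (Nat.cast_ne_zero.2 (Nat.factorial_ne_zero N)) (sgn_ne_zero N))]

omit [LinearOrder Λ] in
/-- The grade involution on a homogeneous element of parity `k`. [cite: Berezin1966, Ch. I §3 (3.1)] -/
theorem involute_eq_neg_one_pow_smul {z : FermiAlg Λ N} {k : ℕ}
    (hz : z ∈ evenOdd ℂ (ι := CIdx Λ N ⊕ₗ CIdx Λ N) (k : ZMod 2)) :
    CliffordAlgebra.involute z = ((-1 : ℂ) ^ k) • z := by
  rcases Nat.even_or_odd k with hk | hk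
  · rw [ZMod.natCast_eq_zero_iff_even.2 hk] at hz
    rw [CliffordAlgebra.involute_eq_of_mem_even hz, hk.neg_one_pow, one_smul]
  · rw [ZMod.natCast_eq_one_iff_odd.2 hk] at hz
    rw [CliffordAlgebra.involute_eq_of_mem_odd hz, hk.neg_one_pow, neg_one_smul]

omit [LinearOrder Λ] in
/-- **Un-interleaving two ordered products of odd elements**:
`(A₀⋯A_{k-1})(C₀⋯C_{k-1}) = (-1)^{∑_{i<k} i} (A₀C₀)(A₁C₁)⋯(A_{k-1}C_{k-1})`. [cite: Berezin1966, Ch. I §3 (3.1)] -/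
theorem prod_ofFn_mul_prod_ofFn_of_odd {k : ℕ} (A C : Fin k → FermiAlg Λ N)
    (hA : ∀ q, A q ∈ evenOdd ℂ (ι := CIdx Λ N ⊕ₗ CIdx Λ N) 1) (hC : ∀ q, C q ∈ evenOdd ℂ (ι := CIdx Λ N ⊕ₗ CIdx Λ N) 1) :
    (List.ofFn A).prod * (List.ofFn C).prod =
      ((-1 : ℂ) ^ (∑ i ∈ Finset.range k, i)) • (List.ofFn fun q => A q * C q).prod := by
  induction k with
  | zero => simp
  | succ k ih =>
    have hTA : (List.ofFn fun q : Fin k => A q.succ).prod ∈ evenOdd ℂ (ι := CIdx Λ N ⊕ₗ CIdx Λ N) (k : ZMod 2) := by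
      have h := SetLike.list_prod_map_mem_graded (A := evenOdd ℂ (ι := CIdx Λ N ⊕ₗ CIdx Λ N)) (List.finRange k)
        (fun _ => (1 : ZMod 2)) (fun q : Fin k => A q.succ) fun q _ => hA q.succ
      rwa [List.map_const', List.sum_replicate, List.length_finRange, nsmul_one, ← List.ofFn_eq_map] at h
    have hswap : (List.ofFn fun q : Fin k => A q.succ).prod * C 0 =
        ((-1 : ℂ) ^ k) • (C 0 * (List.ofFn fun q : Fin k => A q.succ).prod) := by
      rw [mul_eq_mul_involute_of_mem_evenOdd_one (hC 0), involute_eq_neg_one_pow_smul hTA, mul_smul_comm]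
    simp only [List.ofFn_succ, List.prod_cons]
    rw [mul_assoc, ← mul_assoc (List.ofFn fun q : Fin k => A q.succ).prod, hswap, smul_mul_assoc, mul_smul_comm,
      mul_assoc (C 0), ih (fun q => A q.succ) (fun q => C q.succ) (fun q => hA q.succ) (fun q => hC q.succ),
      mul_smul_comm, mul_smul_comm, smul_smul, Finset.sum_range_succ, pow_add, mul_comm ((-1 : ℂ) ^ k),
      mul_assoc (A 0)]

end TopPower

section Assembly

variable {Λ : Type*} [LinearOrder Λ] [Fintype Λ] {N : ℕ}
variable {B : Type*} [Fintype B] [DecidableEq B]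

omit [Fintype Λ] [DecidableEq B] in
/-- For odd `N` the composite fields are odd. [cite: Berezin1966, Ch. I §3 (3.1)] -/
theorem freeFam_mem_evenOdd_one (hN : Odd N) (D : Λ → ℕ) (i : Free D ⊕ₗ Free D) :
    freeFam N D i ∈ evenOdd ℂ (ι := CIdx Λ N ⊕ₗ CIdx Λ N) 1 := by
  rw [← toLex_ofLex i]
  cases ofLex i with
  | inl u => exact bbar_mem_evenOdd_one hN u.1
  | inr u => exact bar_mem_evenOdd_one hN u.1

omit [Fintype Λ] [DecidableEq B] in
/-- **For odd `N` the composite fields anticommute pairwise.** [cite: Berezin1966, Ch. I §3 (3.1)] -/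
theorem freeFam_anticomm (hN : Odd N) (D : Λ → ℕ) (i j : Free D ⊕ₗ Free D) :
    freeFam N D i * freeFam N D j + freeFam N D j * freeFam N D i = 0 :=
  odd_mul_odd_add (freeFam_mem_evenOdd_one hN D j) (freeFam_mem_evenOdd_one hN D i)

omit [Fintype Λ] [DecidableEq B] in
/-- The composite fields have degree `N`. [cite: Berezin1966, Ch. I §3 (3.3)] -/
theorem freeFam_mem_exteriorPower (D : Λ → ℕ) (i : Free D ⊕ₗ Free D) :
    freeFam N D i ∈ ⋀[ℂ]^N (CIdx Λ N ⊕ₗ CIdx Λ N → ℂ) := by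
  rw [← toLex_ofLex i]
  cases ofLex i with
  | inl u => exact bbar_mem_exteriorPower u.1
  | inr u => exact bar_mem_exteriorPower u.1

omit [Fintype Λ] in
/-- A product of meson powers has degree `∑ 2e_x`. [cite: Berezin1966, Ch. I §3 (3.3)] -/
theorem coe_prod_mesonC_pow_mem (e : Λ → ℕ) (s : Finset Λ) :
    ((∏ x ∈ s, mesonC 1 x ^ e x : Subalgebra.center ℂ (FermiAlg Λ N)) : FermiAlg Λ N) ∈
      ⋀[ℂ]^(∑ x ∈ s, 2 * e x) (CIdx Λ N ⊕ₗ CIdx Λ N → ℂ) := by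
  induction s using Finset.induction_on with
  | empty =>
    rw [Finset.prod_empty, Finset.sum_empty, Subalgebra.coe_one, exteriorPower, pow_zero]
    exact Submodule.mem_one.2 ⟨1, map_one _⟩
  | insert a s ha ih =>
    rw [Finset.prod_insert ha, Finset.sum_insert ha, Subalgebra.coe_mul, Subalgebra.coe_pow, coe_mesonC, one_smul]
    exact mul_mem_exteriorPower (meson_pow_mem_exteriorPower a (e a)) ih

omit [DecidableEq B] in
/-- The meson-power part has degree `∑_x 2 d_n(x)`. [cite: Berezin1966, Ch. I §3 (3.3)] -/
theorem mesonPowD_mem (D : Λ → ℕ) :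
    ((mesonPowD D : Subalgebra.center ℂ (FermiAlg Λ N)) : FermiAlg Λ N) ∈
      ⋀[ℂ]^(∑ x, 2 * D x) (CIdx Λ N ⊕ₗ CIdx Λ N → ℂ) :=
  coe_prod_mesonC_pow_mem _ _

/-- **Deficient degree integrates to zero** along `φ`: if `d + N|S ⊕ S| < |J|` then `∫ P·φ(ω) = 0`. [cite: Berezin1966, Ch. I §3 (3.4)] -/
theorem berezin_mul_compositeHom_eq_zero {J S : Type*} [LinearOrder J] [Fintype J] [LinearOrder S] [Fintype S]
    {x : S ⊕ₗ S → GrassmannAlgebra ℂ J} (hx : ∀ i j, x i * x j + x j * x i = 0) {M d : ℕ}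
    (hdeg : ∀ i, x i ∈ ⋀[ℂ]^M (J → ℂ)) {P : GrassmannAlgebra ℂ J} (hP : P ∈ ⋀[ℂ]^d (J → ℂ))
    (hlt : d + M * Fintype.card (S ⊕ₗ S) < Fintype.card J) (ω : GrassmannAlgebra ℂ (S ⊕ₗ S)) :
    berezin ℂ J (P * compositeHom x hx ω) = 0 := by
  conv_lhs => rw [eq_sum_coord_smul ω]
  rw [map_sum, Finset.mul_sum, map_sum]
  refine Finset.sum_eq_zero fun T _ => ?_
  rw [map_smul, mul_smul_comm, map_smul, smul_eq_mul]
  have hmem := mul_mem_exteriorPower hP (compositeHom_grassmannBasis_mem hx hdeg T)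
  have hne : d + M * T.card ≠ Fintype.card J := by
    have hT : T.card ≤ Fintype.card (S ⊕ₗ S) := by
      rw [← Finset.card_univ]; exact Finset.card_le_card (Finset.subset_univ T)
    have := Nat.mul_le_mul_left M hT
    omega
  rw [berezin_eq_zero_of_mem_exteriorPower ℂ hne hmem, mul_zero]

/-- The baryon–antibaryon product as a central element. [cite: MontvayMunster1994, §5.1.4 (5.44)] -/
def bbarBarC (x : Λ) : Subalgebra.center ℂ (FermiAlg Λ N) :=
  ⟨bbar x * bar x, Subalgebra.mem_center_iff.2 fun z => (commute_bbar_mul_bar x x z).eq.symm⟩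

omit [Fintype Λ] in
/-- `b̄(x)b(x) = (N! ε_N)⁻¹ (ψ̄ψ(x))^N` in the centre. [cite: MontvayMunster1994, §5.1.4 (5.44)] -/
theorem bbarBarC_eq (x : Λ) :
    (bbarBarC x : Subalgebra.center ℂ (FermiAlg Λ N)) = ((N.factorial : ℂ) * sgn N)⁻¹ • mesonC 1 x ^ N := by
  apply Subtype.ext
  rw [Subalgebra.coe_smul, Subalgebra.coe_pow, coe_mesonC, one_smul]
  exact bbar_mul_bar_eq_smul x

omit [DecidableEq B] in
/-- **The image of the top monomial**: `φ(θ_univ) = (-1)^{∑_{i<k} i} (N! ε_N)^{-k} ∏_{u ∈ S} (ψ̄ψ(u))^N`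
(`k = |S|`, `N` odd). [cite: Berezin1966, Ch. I §3 (3.3)] [cite: MontvayMunster1994, §5.1.4 (5.44)] -/
theorem compositeHom_freeFam_top (hN : Odd N) (D : Λ → ℕ) :
    compositeHom (freeFam N D) (freeFam_anticomm hN D) (grassmannBasis ℂ (Free D ⊕ₗ Free D) Finset.univ) =
      ((-1 : ℂ) ^ (∑ i ∈ Finset.range (Fintype.card (Free D)), i) *
          ((N.factorial : ℂ) * sgn N)⁻¹ ^ Fintype.card (Free D)) •
        ((∏ x ∈ Finset.univ.filter (fun x => D x = 0), mesonC 1 x ^ N :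
            Subalgebra.center ℂ (FermiAlg Λ N)) : FermiAlg Λ N) := by
  set c := Fintype.orderIsoFinOfCardEq (Free D) rfl with hc
  rw [compositeHom_grassmannBasis_univ (freeFam_anticomm hN D) c]
  simp only [freeFam_inl, freeFam_inr]
  rw [prod_ofFn_mul_prod_ofFn_of_odd _ _ (fun q => bbar_mem_evenOdd_one hN _) (fun q => bar_mem_evenOdd_one hN _)]
  have hL : (List.ofFn fun q : Fin (Fintype.card (Free D)) => (bbar (c q).1 * bar (c q).1 : FermiAlg Λ N)).prod =
      Finset.univ.noncommProd (fun u : Free D => (bbar u.1 * bar u.1 : FermiAlg Λ N))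
        (fun u _ v _ _ => commute_bbar_mul_bar _ _ _) := by
    rw [noncommProd_univ_eq_prod_ofFn c.toEquiv]; rfl
  have hprod : Finset.univ.noncommProd (fun u : Free D => (bbar u.1 * bar u.1 : FermiAlg Λ N))
      (fun u _ v _ _ => commute_bbar_mul_bar _ _ _) =
      ((∏ u : Free D, bbarBarC (N := N) u.1 : Subalgebra.center ℂ (FermiAlg Λ N)) : FermiAlg Λ N) := by
    rw [coe_prod_center]; rfl
  rw [hL, hprod, Finset.prod_congr rfl fun u _ => bbarBarC_eq (N := N) u.1, Finset.prod_smul, Finset.prod_const,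
    Finset.card_univ,
    ← Finset.prod_subtype (Finset.univ.filter fun x => D x = 0) (fun x => by simp)
      (fun x => (mesonC 1 x ^ N : Subalgebra.center ℂ (FermiAlg Λ N))),
    Subalgebra.coe_smul, smul_smul]

/-! ### Stage B4b: cardinalities and the evaluation of a term -/

omit [LinearOrder Λ] in
/-- `|CIdx ⊕ CIdx| = 2N|Λ|`. [cite: SalmhoferSeiler1991, §2 (2.6)] -/
theorem card_CIdx_sumLex : Fintype.card (CIdx Λ N ⊕ₗ CIdx Λ N) = 2 * (N * Fintype.card Λ) := by
  simp only [CIdx, Fintype.card_lex, Fintype.card_sum, Fintype.card_prod, Fintype.card_fin]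
  ring

omit [LinearOrder Λ] in
/-- `|S ⊕ S| = 2|S|`. [cite: FrommForcrand2008, (6)] -/
theorem card_free_sumLex (D : Λ → ℕ) :
    Fintype.card (Free D ⊕ₗ Free D) = 2 * (Finset.univ.filter fun x => D x = 0).card := by
  rw [Fintype.card_lex, Fintype.card_sum, Fintype.card_subtype]
  ring

omit [LinearOrder Λ] in
/-- For an admissible configuration `∑_x 2d_n(x) = 2N |V(n)|`. [cite: FrommForcrand2008, (6)] -/
theorem sum_two_mul_eq (D : Λ → ℕ) (hadm : ∀ x, D x = 0 ∨ D x = N) :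
    ∑ x, 2 * D x = 2 * N * (Finset.univ.filter fun x => ¬D x = 0).card := by
  rw [Finset.card_eq_sum_ones, Finset.mul_sum, Finset.sum_filter]
  refine Finset.sum_congr rfl fun x _ => ?_
  rcases hadm x with h | h
  · simp [h]
  · rw [h]
    by_cases h0 : N = 0 <;> simp [h0]

omit [LinearOrder Λ] in
/-- **Admissible configurations saturate the degree**: `∑_x 2d_n(x) + N|S ⊕ S| = |CIdx ⊕ CIdx|`. [cite: FrommForcrand2008, (6)] -/
theorem card_eq_of_adm (D : Λ → ℕ) (hadm : ∀ x, D x = 0 ∨ D x = N) :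
    (∑ x, 2 * D x) + N * Fintype.card (Free D ⊕ₗ Free D) = Fintype.card (CIdx Λ N ⊕ₗ CIdx Λ N) := by
  rw [sum_two_mul_eq D hadm, card_free_sumLex, card_CIdx_sumLex, ← Finset.card_univ (α := Λ),
    ← Finset.card_filter_add_card_filter_not (s := Finset.univ) (fun x => D x = 0)]
  ring

omit [LinearOrder Λ] in
/-- **Non-admissible configurations without over-saturation are degree-deficient.** [cite: FrommForcrand2008, (6)] -/
theorem card_lt_of_not_adm (D : Λ → ℕ) (hle : ∀ x, D x ≤ N)
    (hna : ¬∀ x, D x = 0 ∨ D x = N) :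
    (∑ x, 2 * D x) + N * Fintype.card (Free D ⊕ₗ Free D) < Fintype.card (CIdx Λ N ⊕ₗ CIdx Λ N) := by
  obtain ⟨x0, hx0⟩ := not_forall.1 hna
  have hlt : ∑ x, 2 * D x < ∑ x, (if D x = 0 then 0 else 2 * N) := by
    refine Finset.sum_lt_sum (fun x _ => ?_) ⟨x0, Finset.mem_univ _, ?_⟩
    · split_ifs with h
      · rw [h]
      · exact Nat.mul_le_mul_left 2 (hle x)
    · rw [if_neg fun h => hx0 (Or.inl h)]
      have : D x0 < N := lt_of_le_of_ne (hle x0) fun h => hx0 (Or.inr h)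
      omega
  have hsum : ∑ x, (if D x = 0 then 0 else 2 * N) = 2 * N * (Finset.univ.filter fun x => ¬D x = 0).card := by
    rw [Finset.card_eq_sum_ones, Finset.mul_sum, Finset.sum_filter]
    exact Finset.sum_congr rfl fun x _ => by split_ifs <;> simp
  rw [hsum] at hlt
  rw [card_free_sumLex, card_CIdx_sumLex, ← Finset.card_univ (α := Λ),
    ← Finset.card_filter_add_card_filter_not (s := Finset.univ) (fun x => D x = 0)]
  linarith

omit [DecidableEq B] in
/-- For an admissible configuration the meson powers and the untouched sites together saturate every
site: `∏_x ψ̄ψ(x)^{d_n(x)} · ∏_{u ∈ S} ψ̄ψ(u)^N = ∏_x ψ̄ψ(x)^N`. [cite: FrommForcrand2008, (6)] -/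
theorem mesonPowD_mul_prod_free (D : Λ → ℕ) (hadm : ∀ x, D x = 0 ∨ D x = N) :
    (mesonPowD D * ∏ x ∈ Finset.univ.filter (fun x => D x = 0), mesonC 1 x ^ N :
        Subalgebra.center ℂ (FermiAlg Λ N)) = ∏ x, mesonC 1 x ^ N := by
  rw [mesonPowD, ← Finset.prod_filter_mul_prod_filter_not Finset.univ (fun x => D x = 0)
    (fun x => (mesonC 1 x ^ D x : Subalgebra.center ℂ (FermiAlg Λ N)))]
  have h1 : ∏ x ∈ Finset.univ.filter (fun x => D x = 0),
      (mesonC 1 x ^ D x : Subalgebra.center ℂ (FermiAlg Λ N)) = 1 :=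
    Finset.prod_eq_one fun x hx => by rw [(Finset.mem_filter.1 hx).2, pow_zero]
  have h2 : ∏ x ∈ Finset.univ.filter (fun x => ¬D x = 0),
      (mesonC 1 x ^ D x : Subalgebra.center ℂ (FermiAlg Λ N)) =
      ∏ x ∈ Finset.univ.filter (fun x => ¬D x = 0), mesonC 1 x ^ N :=
    Finset.prod_congr rfl fun x hx => by rw [(hadm x).resolve_left (Finset.mem_filter.1 hx).2]
  rw [h1, one_mul, h2, mul_comm, Finset.prod_filter_mul_prod_filter_not]

variable (N) in
/-- **The baryon determinant** `det K_{S(n)}` of a partial-dimer configuration. [cite: FrommForcrand2008, (6)] -/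
def baryonDet (l : B → Λ × Λ) (Γ : B → ℂ) (D : Λ → ℕ) : ℂ := (Kmat N l Γ D).det

omit [DecidableEq B] in
/-- `det K_{S(n)}` does not depend on the decidability instance used to state it. [cite: FrommForcrand2008, (6)] -/
theorem det_Kmat_eq (l : B → Λ × Λ) (Γ : B → ℂ) (D : Λ → ℕ) {inst : DecidableEq (Free D)} :
    @Matrix.det (Free D) inst _ ℂ _ (Kmat N l Γ D) = baryonDet N l Γ D := by
  unfold baryonDet; congr

omit [DecidableEq B] in
/-- Inserting a mesonic observable `∏_x (ψ̄ψ(x))^{e(x)}` into a term shifts the site degrees: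
`(∏_x ψ̄ψ(x)^{e(x)}) ∏_b piece_b(n_b) = (∏_b c_{n_b}) · ∏_x ψ̄ψ(x)^{d_n(x)+e(x)} · ∏_{n_b=0} exp(hops_b)`. [cite: FrommForcrand2008, (6)] -/
theorem obs_mul_prod_linkPieceC_eq (hN : 0 < N) (l : B → Λ × Λ) (Γ : B → ℂ) (n : B → Fin N) (e : Λ → ℕ) :
    ((∏ x, mesonC 1 x ^ e x) * ∏ b, linkPieceC hN l Γ b (n b) : Subalgebra.center ℂ (FermiAlg Λ N)) =
      (∏ b, dimerCoeff N (n b)) •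
        (mesonPowD (siteDeg l n + e) * ∏ b ∈ Finset.univ.filter (fun b => (n b : ℕ) = 0), hopExpC hN l Γ b) := by
  have hM : ((∏ x, mesonC 1 x ^ e x) * mesonPowD (siteDeg l n) : Subalgebra.center ℂ (FermiAlg Λ N)) =
      mesonPowD (siteDeg l n + e) := by
    rw [mesonPowD, mesonPowD, ← Finset.prod_mul_distrib]
    exact Finset.prod_congr rfl fun x _ => by rw [← pow_add, Pi.add_apply, add_comm]
  rw [prod_linkPieceC_eq, mul_smul_comm, ← mul_assoc, hM]

/-- **The Berezin integral of one term of the partial-dimer expansion with a mesonic observable**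
(`N` odd): with `D = d_n + e`,
`∫ (∏_x ψ̄ψ(x)^{e(x)}) ∏_b piece_b(n_b) = [∀ x, D(x) ∈ {0, N}] · ∏_b c_{n_b} · (N! ε_N)^{-|S_D|} det K_{S_D} · σ_Λ (N!)^{|Λ|}`,
`S_D = {x : D(x) = 0}` — the composite Gaussian integral over the untouched sites; other configurations
vanish by nilpotency (`D(x) > N`) or by degree counting. [cite: FrommForcrand2008, (6)] [cite: Berezin1966, Ch. I §3 Thm 3.1] -/
theorem berezin_obs_term_eq (hN : Odd N) (l : B → Λ × Λ) (Γ : B → ℂ) (n : B → Fin N) (e : Λ → ℕ) :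
    berezin ℂ _ ((((∏ x, mesonC 1 x ^ e x) * ∏ b, linkPieceC hN.pos l Γ b (n b) :
        Subalgebra.center ℂ (FermiAlg Λ N))) : FermiAlg Λ N) =
      if (∀ x, (siteDeg l n + e) x = 0 ∨ (siteDeg l n + e) x = N) then
        (∏ b, dimerCoeff N (n b)) *
          ((((N.factorial : ℂ) * sgn N)⁻¹ ^ Fintype.card (Free (siteDeg l n + e)) * baryonDet N l Γ (siteDeg l n + e)) *
            (sgn (Fintype.card (CIdx Λ N)) * (N.factorial : ℂ) ^ Fintype.card Λ))
      else 0 := by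
  have hE : (Finset.univ.filter fun b => (n b : ℕ) = 0).noncommProd (fun b => (hopExpC hN.pos l Γ b : FermiAlg Λ N))
      (fun i _ j _ _ => (Subalgebra.mem_center_iff.1 (hopExpC hN.pos l Γ i).2 (hopExpC hN.pos l Γ j : FermiAlg Λ N)).symm) =
      grassmannExp (∑ b ∈ Finset.univ.filter (fun b => (n b : ℕ) = 0), hopSU l Γ b) := by
    rw [grassmannExp_sum_of_mem_evenOdd_zero _ (hopSU l Γ) (hopSU_mem_evenOdd_zero l Γ) (isNilpotent_hopSU hN.pos l Γ)]
    rfl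
  rw [obs_mul_prod_linkPieceC_eq, Subalgebra.coe_smul, map_smul, smul_eq_mul, Subalgebra.coe_mul, coe_finset_prod_center,
    hE, mesonPowD_mul_grassmannExp_sum_hopSU hN.pos,
    filter_filter_untouched l n (siteDeg l n + e) fun x => Nat.le_add_right _ _, sum_hopSU_untouched_eq]
  split_ifs with hadm
  · rw [berezin_mul_grassmannExp_composite (freeFam_anticomm hN (siteDeg l n + e))
      (freeFam_mem_exteriorPower (siteDeg l n + e)) hN.pos (mesonPowD_mem (siteDeg l n + e))
      (card_eq_of_adm (siteDeg l n + e) hadm) (Kmat N l Γ (siteDeg l n + e)), det_Kmat_eq,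
      compositeHom_freeFam_top hN (siteDeg l n + e), mul_smul_comm, map_smul, ← Subalgebra.coe_mul,
      mesonPowD_mul_prod_free (siteDeg l n + e) hadm, berezin_coe_prod_mesonC_pow, if_pos fun _ => rfl, one_pow,
      one_mul, smul_eq_mul, Finset.sum_range_id]
    have hs : ((-1 : ℂ) ^ (Fintype.card (Free (siteDeg l n + e)) * (Fintype.card (Free (siteDeg l n + e)) - 1) / 2)) *
        (-1) ^ (Fintype.card (Free (siteDeg l n + e)) * (Fintype.card (Free (siteDeg l n + e)) - 1) / 2) = 1 := by
      rw [← pow_add, ← two_mul, pow_mul, neg_one_sq, one_pow]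
    linear_combination (∏ b, dimerCoeff N (n b)) * baryonDet N l Γ (siteDeg l n + e) *
      ((N.factorial : ℂ) * sgn N)⁻¹ ^ Fintype.card (Free (siteDeg l n + e)) *
        (sgn (Fintype.card (CIdx Λ N)) * (N.factorial : ℂ) ^ Fintype.card Λ) * hs
  · by_cases hbig : ∃ x, N < (siteDeg l n + e) x
    · obtain ⟨x, hx⟩ := hbig
      rw [coe_mesonPowD_eq_mul (siteDeg l n + e) x, meson_pow_eq_zero x hx, mul_zero, zero_mul, map_zero, mul_zero]
    · have hle : ∀ x, (siteDeg l n + e) x ≤ N := fun x => not_lt.1 fun h => hbig ⟨x, h⟩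
      rw [← compositeHom_quadratic (freeFam_anticomm hN (siteDeg l n + e)),
        ← compositeHom_grassmannExp_quadratic (freeFam_anticomm hN (siteDeg l n + e)),
        berezin_mul_compositeHom_eq_zero (freeFam_anticomm hN (siteDeg l n + e))
          (freeFam_mem_exteriorPower (siteDeg l n + e)) (mesonPowD_mem (siteDeg l n + e))
          (card_lt_of_not_adm (siteDeg l n + e) hle hadm), mul_zero]

/-- **ALL MESONIC MOMENTS AS SUMS OF BARYON DETERMINANTS** (`G = SU(N)`, `N` odd, `β = 0`, `m = 0`, one
staggered flavour, distinct endpoints, `Γ_b² = 1`): for every `e : Λ → ℕ`, with `D = d_n + e`,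
`∫𝒟ψ̄𝒟ψ𝒟V e^{-S_F} ∏_x (ψ̄ψ(x))^{e(x)} = σ_Λ (N!)^{|Λ|} ∑_{n : ∀ x, D(x) ∈ {0,N}} [∏_b c_{n_b}] (N! ε_N)^{-|S_D|} det K_{S_D}`
(the monomer–dimer–polymer expansion (6) with `e(x)` "monomers" at `x` and the signed baryon loops
RESUMMED into determinants). [cite: FrommForcrand2008, (4)–(6)] [cite: Berezin1966, Ch. I §3 Thm 3.1] -/
theorem fermiBracketSU_mesonPow_eq_sum_det (hN : Odd N) (l : B → Λ × Λ) (hl : ∀ b, (l b).1 ≠ (l b).2) (Γ : B → ℂ)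
    (hΓ : ∀ b, Γ b ^ 2 = 1) (e : Λ → ℕ) :
    fermiBracketSU l Γ 0 (fun _ => (((∏ x, mesonC 1 x ^ e x : Subalgebra.center ℂ (FermiAlg Λ N))) : FermiAlg Λ N)) =
      sgn (Fintype.card (CIdx Λ N)) * (N.factorial : ℂ) ^ Fintype.card Λ *
        ∑ n : B → Fin N,
          if (∀ x, (siteDeg l n + e) x = 0 ∨ (siteDeg l n + e) x = N) then
            (∏ b, dimerCoeff N (n b)) *
              (((N.factorial : ℂ) * sgn N)⁻¹ ^ Fintype.card (Free (siteDeg l n + e)) * baryonDet N l Γ (siteDeg l n + e))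
          else 0 := by
  rw [fermiBracketSU_const l hl Γ 0, gaugeAverageSU_zero_eq_sum hN.pos l hl Γ hΓ, Finset.mul_sum, map_sum,
    Finset.mul_sum]
  refine Finset.sum_congr rfl fun n _ => ?_
  rw [← Subalgebra.coe_mul, berezin_obs_term_eq hN l Γ n e]
  split_ifs
  · ring
  · rw [mul_zero]

/-- **THE PARTITION FUNCTION AS A SUM OF BARYON DETERMINANTS** (`G = SU(N)`, `N` odd, `β = 0`, `m = 0`,
one staggered flavour, distinct endpoints, `Γ_b² = 1`):
`Z = σ_Λ (N!)^{|Λ|} ∑_{n admissible} [∏_b (N-n_b)!/(N! n_b!) 4^{-n_b}] (N! ε_N)^{-|S(n)|} det K_{S(n)}`, the sum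
over partial dimer numbers `n_b ∈ {0,…,N-1}` with every site saturated or untouched, `K_{S(n)}` the baryon
hopping matrix on the untouched sites (Fromm–de Forcrand (6) with the signed baryon loops `∏ w(C_B)`
RESUMMED into determinants). [cite: FrommForcrand2008, (4)–(6)] [cite: Berezin1966, Ch. I §3 Thm 3.1] -/
theorem fermiZSU_eq_sum_det (hN : Odd N) (l : B → Λ × Λ) (hl : ∀ b, (l b).1 ≠ (l b).2) (Γ : B → ℂ)
    (hΓ : ∀ b, Γ b ^ 2 = 1) :
    fermiZSU (N := N) l Γ 0 =
      sgn (Fintype.card (CIdx Λ N)) * (N.factorial : ℂ) ^ Fintype.card Λ *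
        ∑ n : B → Fin N,
          if (∀ x, siteDeg l n x = 0 ∨ siteDeg l n x = N) then
            (∏ b, dimerCoeff N (n b)) *
              (((N.factorial : ℂ) * sgn N)⁻¹ ^ Fintype.card (Free (siteDeg l n)) * baryonDet N l Γ (siteDeg l n))
          else 0 := by
  have h := fermiBracketSU_mesonPow_eq_sum_det hN l hl Γ hΓ 0
  simp only [Pi.zero_apply, pow_zero, Finset.prod_const_one, Subalgebra.coe_one, add_zero] at h
  exact h

end Assembly

/-! ### Stage B5: the reduced hopping matrix; positivity of every term for odd `N` -/

section Positivity

variable {Λ : Type*} [LinearOrder Λ] [Fintype Λ] {N : ℕ}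
variable {B : Type*} [Fintype B] [DecidableEq B]

variable (N) in
/-- **The reduced baryon hopping matrix** `K̃_{x_b y_b} = (-Γ_b/2)^N`, `K̃_{y_b x_b} = (Γ_b/2)^N` (summed over
parallel links; `K = ε_N K̃`). [cite: FrommForcrand2008, (5)–(6)] -/
def Kred (l : B → Λ × Λ) (Γ : B → ℂ) (D : Λ → ℕ) : Matrix (Free D) (Free D) ℂ := fun u v =>
  ∑ b, ((if (l b).1 = u.1 ∧ (l b).2 = v.1 then (-(Γ b / 2)) ^ N else 0) +
    (if (l b).1 = v.1 ∧ (l b).2 = u.1 then (Γ b / 2) ^ N else 0))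

omit [Fintype Λ] [DecidableEq B] in
/-- `K = ε_N K̃`. [cite: FrommForcrand2008, (5)–(6)] -/
theorem Kmat_eq_smul_Kred (l : B → Λ × Λ) (Γ : B → ℂ) (D : Λ → ℕ) : Kmat N l Γ D = sgn N • Kred N l Γ D := by
  ext u v
  simp only [Kmat, Kred, Matrix.smul_apply, smul_eq_mul, Finset.mul_sum, mul_add, mul_ite, mul_zero, kapF, kapB, sgn_eq]

omit [DecidableEq B] in
/-- `det K_{S} = ε_N^{|S|} det K̃_{S}`. [cite: FrommForcrand2008, (6)] -/
theorem baryonDet_eq (l : B → Λ × Λ) (Γ : B → ℂ) (D : Λ → ℕ) :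
    baryonDet N l Γ D = sgn N ^ Fintype.card (Free D) * (Kred N l Γ D).det := by
  rw [baryonDet, Kmat_eq_smul_Kred, Matrix.det_smul]

/-- **ALL MESONIC MOMENTS AS SUMS OF REDUCED BARYON DETERMINANTS** (`N` odd; the signs `ε_N` cancel):
`∫ e^{-S_F} ∏_x ψ̄ψ(x)^{e(x)} = σ_Λ (N!)^{|Λ|} ∑_{n : D ∈ {0,N}^Λ} [∏_b c_{n_b}] (N!)^{-|S_D|} det K̃_{S_D}`, `D = d_n + e`. [cite: FrommForcrand2008, (4)–(6)] [cite: Berezin1966, Ch. I §3 Thm 3.1] -/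
theorem fermiBracketSU_mesonPow_eq_sum_det_red (hN : Odd N) (l : B → Λ × Λ) (hl : ∀ b, (l b).1 ≠ (l b).2)
    (Γ : B → ℂ) (hΓ : ∀ b, Γ b ^ 2 = 1) (e : Λ → ℕ) :
    fermiBracketSU l Γ 0 (fun _ => (((∏ x, mesonC 1 x ^ e x : Subalgebra.center ℂ (FermiAlg Λ N))) : FermiAlg Λ N)) =
      sgn (Fintype.card (CIdx Λ N)) * (N.factorial : ℂ) ^ Fintype.card Λ *
        ∑ n : B → Fin N,
          if (∀ x, (siteDeg l n + e) x = 0 ∨ (siteDeg l n + e) x = N) then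
            (∏ b, dimerCoeff N (n b)) *
              ((N.factorial : ℂ)⁻¹ ^ Fintype.card (Free (siteDeg l n + e)) * (Kred N l Γ (siteDeg l n + e)).det)
          else 0 := by
  rw [fermiBracketSU_mesonPow_eq_sum_det hN l hl Γ hΓ e]
  congr 1
  refine Finset.sum_congr rfl fun n _ => ?_
  split_ifs
  · have hsg : (sgn N)⁻¹ ^ Fintype.card (Free (siteDeg l n + e)) * sgn N ^ Fintype.card (Free (siteDeg l n + e)) = 1 := by
      rw [← mul_pow, inv_mul_cancel₀ (sgn_ne_zero N), one_pow]
    rw [baryonDet_eq, mul_inv, mul_pow]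
    linear_combination (∏ b, dimerCoeff N (n b)) * (N.factorial : ℂ)⁻¹ ^ Fintype.card (Free (siteDeg l n + e)) *
      (Kred N l Γ (siteDeg l n + e)).det * hsg
  · rfl

/-- **`Z` AS A SUM OF REDUCED BARYON DETERMINANTS** (`N` odd; the signs `ε_N` cancel):
`Z = σ_Λ (N!)^{|Λ|} ∑_{n admissible} [∏_b (N-n_b)!/(N! n_b!) 4^{-n_b}] (N!)^{-|S(n)|} det K̃_{S(n)}`. [cite: FrommForcrand2008, (4)–(6)] [cite: Berezin1966, Ch. I §3 Thm 3.1] -/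
theorem fermiZSU_eq_sum_det_red (hN : Odd N) (l : B → Λ × Λ) (hl : ∀ b, (l b).1 ≠ (l b).2) (Γ : B → ℂ)
    (hΓ : ∀ b, Γ b ^ 2 = 1) :
    fermiZSU (N := N) l Γ 0 =
      sgn (Fintype.card (CIdx Λ N)) * (N.factorial : ℂ) ^ Fintype.card Λ *
        ∑ n : B → Fin N,
          if (∀ x, siteDeg l n x = 0 ∨ siteDeg l n x = N) then
            (∏ b, dimerCoeff N (n b)) * ((N.factorial : ℂ)⁻¹ ^ Fintype.card (Free (siteDeg l n)) * (Kred N l Γ (siteDeg l n)).det)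
          else 0 := by
  have h := fermiBracketSU_mesonPow_eq_sum_det_red hN l hl Γ hΓ 0
  simp only [Pi.zero_apply, pow_zero, Finset.prod_const_one, Subalgebra.coe_one, add_zero] at h
  exact h

variable (N) in
/-- The reduced hopping matrix for REAL link signs, as a real matrix. [cite: FrommForcrand2008, (5)–(6)] -/
def KredR (l : B → Λ × Λ) (γ : B → ℝ) (D : Λ → ℕ) : Matrix (Free D) (Free D) ℝ := fun u v =>
  ∑ b, ((if (l b).1 = u.1 ∧ (l b).2 = v.1 then (-(γ b / 2)) ^ N else 0) +
    (if (l b).1 = v.1 ∧ (l b).2 = u.1 then (γ b / 2) ^ N else 0))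

omit [DecidableEq B] in
/-- For real signs `K̃` is the complexification of `K̃_ℝ`. [cite: FrommForcrand2008, (5)–(6)] -/
theorem Kred_ofReal (l : B → Λ × Λ) (γ : B → ℝ) (D : Λ → ℕ) :
    Kred N l (fun b => (γ b : ℂ)) D = Complex.ofRealHom.mapMatrix (KredR N l γ D) := by
  ext u v
  rw [RingHom.mapMatrix_apply, Matrix.map_apply, Kred, KredR, Complex.ofRealHom_eq_coe, Complex.ofReal_sum]
  refine Finset.sum_congr rfl fun b _ => ?_
  split_ifs <;> push_cast <;> ring

omit [DecidableEq B] in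
/-- `det K̃ = det K̃_ℝ` for real signs. [cite: FrommForcrand2008, (6)] -/
theorem det_Kred_ofReal (l : B → Λ × Λ) (γ : B → ℝ) (D : Λ → ℕ) :
    (Kred N l (fun b => (γ b : ℂ)) D).det = ((KredR N l γ D).det : ℂ) := by
  rw [Kred_ofReal, ← RingHom.map_det, Complex.ofRealHom_eq_coe]

omit [Fintype Λ] [DecidableEq B] in
/-- **For odd `N` the reduced hopping matrix is alternating**: `K̃ᵀ = -K̃`. [cite: FrommForcrand2008, (5)] -/
theorem KredR_transpose (hN : Odd N) (l : B → Λ × Λ) (γ : B → ℝ) (D : Λ → ℕ) :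
    (KredR N l γ D)ᵀ = -KredR N l γ D := by
  ext u v
  simp only [Matrix.transpose_apply, Matrix.neg_apply, KredR, ← Finset.sum_neg_distrib, hN.neg_pow]
  exact Finset.sum_congr rfl fun b _ => by split_ifs <;> ring

omit [Fintype Λ] [DecidableEq B] in
/-- For odd `N` the reduced hopping matrix has zero diagonal. [cite: FrommForcrand2008, (5)] -/
theorem KredR_diag (hN : Odd N) (l : B → Λ × Λ) (γ : B → ℝ) (D : Λ → ℕ) (u : Free D) : KredR N l γ D u u = 0 := by
  have h := congrFun (congrFun (KredR_transpose hN l γ D) u) u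
  rw [Matrix.transpose_apply, Matrix.neg_apply] at h
  linarith

omit [DecidableEq B] in
/-- **`det K̃_{S} ≥ 0`** for odd `N` and real signs: the determinant of a real alternating matrix is the
square of its Pfaffian. [cite: Cayley1849, pp. 93–96] [cite: Godsil1993, Ch. 7 Thm 2.3] -/
theorem det_KredR_nonneg (hN : Odd N) (l : B → Λ × Λ) (γ : B → ℝ) (D : Λ → ℕ) : 0 ≤ (KredR N l γ D).det :=
  (Literature.LinearAlgebra.Matrix.isSquare_det_of_transpose_eq_neg _ (KredR_transpose hN l γ D)
    (KredR_diag hN l γ D)).nonneg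

/-- The dimer coefficients are real. [cite: FrommForcrand2008, (5)] -/
theorem dimerCoeff_eq_ofReal (j : ℕ) :
    dimerCoeff N j = ((((N - j).factorial : ℝ) / ((N.factorial : ℝ) * (j.factorial : ℝ)) * (1 / 4 : ℝ) ^ j : ℝ) : ℂ) := by
  rw [dimerCoeff]; push_cast; rfl

/-- The dimer coefficients are nonnegative. [cite: FrommForcrand2008, (5)] -/
theorem dimerCoeffR_nonneg (j : ℕ) : 0 ≤ ((N - j).factorial : ℝ) / ((N.factorial : ℝ) * (j.factorial : ℝ)) * (1 / 4 : ℝ) ^ j := by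
  positivity

omit [DecidableEq B] in
open scoped ComplexOrder in
/-- **EVERY TERM OF THE DETERMINANT EXPANSION IS NONNEGATIVE** (`N` odd, `Γ_b = ±1`): the weight
`∏_b c_{n_b} (N!)^{-|S_D|} det K̃_{S_D}` is `≥ 0` for every configuration `n` and every degree pattern
`D` — no sign problem is left after resumming the baryon loops into Pfaffians (compare Karsch–Mütter's
regrouping, Fromm–de Forcrand (7): "for `μ = 0` one recovers non-negative weights"). [cite: FrommForcrand2008, (6)–(7)] [cite: Cayley1849, pp. 93–96] -/
theorem term_nonneg (hN : Odd N) (l : B → Λ × Λ) (Γ : B → ℂ) (hΓ : ∀ b, Γ b = 1 ∨ Γ b = -1) (n : B → Fin N)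
    (D : Λ → ℕ) :
    0 ≤ (∏ b, dimerCoeff N (n b)) * ((N.factorial : ℂ)⁻¹ ^ Fintype.card (Free D) * (Kred N l Γ D).det) := by
  have hΓ' : Γ = fun b => (((Γ b).re : ℝ) : ℂ) := funext fun b => by rcases hΓ b with h | h <;> simp [h]
  rw [hΓ', det_Kred_ofReal, Finset.prod_congr rfl fun b _ => dimerCoeff_eq_ofReal (N := N) (n b : ℕ),
    ← Complex.ofReal_prod, ← Complex.ofReal_natCast, ← Complex.ofReal_inv, ← Complex.ofReal_pow,
    ← Complex.ofReal_mul, ← Complex.ofReal_mul, Complex.zero_le_real]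
  exact mul_nonneg (Finset.prod_nonneg fun b _ => dimerCoeffR_nonneg _)
    (mul_nonneg (pow_nonneg (inv_nonneg.2 (Nat.cast_nonneg _)) _) (det_KredR_nonneg hN l _ D))

open scoped ComplexOrder in
/-- **POSITIVITY OF ALL MESONIC MOMENTS** (`β = 0`, `m = 0`, `SU(N)` with `N` odd, `Γ_b = ±1`):
`σ_Λ ∫ e^{-S_F} ∏_x ψ̄ψ(x)^{e(x)} ≥ 0` for every `e : Λ → ℕ`, as a sum of nonnegative terms. [cite: FrommForcrand2008, (6)–(7)] [cite: Cayley1849, pp. 93–96] -/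
theorem sgn_mul_fermiBracketSU_mesonPow_nonneg (hN : Odd N) (l : B → Λ × Λ) (hl : ∀ b, (l b).1 ≠ (l b).2)
    (Γ : B → ℂ) (hΓ : ∀ b, Γ b = 1 ∨ Γ b = -1) (e : Λ → ℕ) :
    0 ≤ sgn (Fintype.card (CIdx Λ N)) *
      fermiBracketSU l Γ 0 (fun _ => (((∏ x, mesonC 1 x ^ e x : Subalgebra.center ℂ (FermiAlg Λ N))) : FermiAlg Λ N)) := by
  have hΓ2 : ∀ b, Γ b ^ 2 = 1 := fun b => by rcases hΓ b with h | h <;> simp [h]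
  rw [fermiBracketSU_mesonPow_eq_sum_det_red hN l hl Γ hΓ2 e, ← mul_assoc, ← mul_assoc, sgn_mul_self, one_mul]
  refine mul_nonneg (pow_nonneg (Nat.cast_nonneg _) _) (Finset.sum_nonneg fun n _ => ?_)
  split_ifs
  · exact term_nonneg hN l Γ hΓ n _
  · exact le_rfl

open scoped ComplexOrder in
/-- **POSITIVITY OF THE `β = 0`, `m = 0` `SU(N)` PARTITION FUNCTION FOR ODD `N`**: `σ_Λ Z ≥ 0`, and indeed
`σ_Λ Z` is a sum of nonnegative terms (`term_nonneg`) — the baryon-loop signs `ε(C_B)` of the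
monomer–dimer–polymer representation are absorbed into determinants of real alternating matrices.
Honest framing: `β = 0`, `m = 0`, `N` odd, `Γ_b = ±1`, distinct endpoints; nothing about `β > 0`. [cite: FrommForcrand2008, (6)–(7)] [cite: Cayley1849, pp. 93–96] -/
theorem sgn_mul_fermiZSU_nonneg (hN : Odd N) (l : B → Λ × Λ) (hl : ∀ b, (l b).1 ≠ (l b).2) (Γ : B → ℂ)
    (hΓ : ∀ b, Γ b = 1 ∨ Γ b = -1) : 0 ≤ sgn (Fintype.card (CIdx Λ N)) * fermiZSU (N := N) l Γ 0 := by
  have h := sgn_mul_fermiBracketSU_mesonPow_nonneg hN l hl Γ hΓ 0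
  simp only [Pi.zero_apply, pow_zero, Finset.prod_const_one, Subalgebra.coe_one] at h
  exact h

end Positivity

/-! ### Stage B6: monomers — the massive partition function `Z(m)` -/

section Monomers

variable {Λ : Type*} [LinearOrder Λ] [Fintype Λ] {N : ℕ}
variable {B : Type*} [Fintype B] [DecidableEq B]

omit [Fintype Λ] in
/-- `e^{m ψ̄ψ(x)} = ∑_{j=0}^{N} (m^j/j!) (ψ̄ψ(x))^j` as an element of the centre. [cite: SalmhoferSeiler1991, §2 (2.19)–(2.21)] -/
theorem grassmannExp_smul_meson_eq_coe_sum (m : ℂ) (x : Λ) :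
    grassmannExp (m • (meson x : FermiAlg Λ N)) =
      ((∑ j : Fin (N + 1), (m ^ (j : ℕ) / ((j : ℕ).factorial : ℂ)) • mesonC 1 x ^ (j : ℕ) :
        Subalgebra.center ℂ (FermiAlg Λ N)) : FermiAlg Λ N) := by
  rw [grassmannExp_smul_meson, AddSubmonoidClass.coe_finsetSum,
    ← Fin.sum_univ_eq_sum_range (fun j => (m ^ j / (j.factorial : ℂ)) • (meson x : FermiAlg Λ N) ^ j) (N + 1)]
  refine Finset.sum_congr rfl fun j _ => ?_
  rw [Subalgebra.coe_smul, Subalgebra.coe_pow, coe_mesonC, one_smul]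

/-- **The monomer expansion of the site factors**: `∏_x e^{m ψ̄ψ(x)} = ∑_{e : Λ → {0,…,N}} (∏_x m^{e_x}/e_x!) ∏_x ψ̄ψ(x)^{e_x}`
(`e_x` monomers at `x`). [cite: FrommForcrand2008, (6)] [cite: SalmhoferSeiler1991, §2 (2.19)–(2.21)] -/
theorem noncommProd_grassmannExp_smul_meson_eq_sum (m : ℂ) :
    Finset.univ.noncommProd (fun x => grassmannExp (m • (meson x : FermiAlg Λ N)))
        (fun x _ _ _ _ => commute_grassmannExp_smul_meson m x _) =
      ∑ e : Λ → Fin (N + 1), (∏ x, m ^ (e x : ℕ) / ((e x : ℕ).factorial : ℂ)) •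
        ((∏ x, mesonC 1 x ^ (e x : ℕ) : Subalgebra.center ℂ (FermiAlg Λ N)) : FermiAlg Λ N) := by
  have h : Finset.univ.noncommProd (fun x => grassmannExp (m • (meson x : FermiAlg Λ N)))
      (fun x _ _ _ _ => commute_grassmannExp_smul_meson m x _) =
      ((∏ x, ∑ j : Fin (N + 1), (m ^ (j : ℕ) / ((j : ℕ).factorial : ℂ)) • mesonC 1 x ^ (j : ℕ) :
        Subalgebra.center ℂ (FermiAlg Λ N)) : FermiAlg Λ N) := by
    rw [coe_prod_center]
    exact Finset.noncommProd_congr rfl (fun x _ => grassmannExp_smul_meson_eq_coe_sum m x) _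
  rw [h, Fintype.prod_sum, AddSubmonoidClass.coe_finsetSum]
  refine Finset.sum_congr rfl fun e _ => ?_
  rw [Finset.prod_smul, Subalgebra.coe_smul]

/-- **`Z(m)` AS A MONOMER SUM OF MESONIC MOMENTS** (`N ≥ 1`, distinct endpoints, `Γ_b² = 1`):
`Z(m) = ∑_{e : Λ → {0,…,N}} (∏_x m^{e_x}/e_x!) ∫ e^{-S_F}|_{m=0} ∏_x ψ̄ψ(x)^{e_x}` — Fromm–de Forcrand (6)
with `n_x = e_x` monomers, the rest resummed by `fermiBracketSU_mesonPow_eq_sum_det_red`. [cite: FrommForcrand2008, (4)–(6)] -/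
theorem fermiZSU_eq_sum_monomer (hN : 0 < N) (l : B → Λ × Λ) (hl : ∀ b, (l b).1 ≠ (l b).2) (Γ : B → ℂ)
    (hΓ : ∀ b, Γ b ^ 2 = 1) (m : ℂ) :
    fermiZSU (N := N) l Γ m =
      ∑ e : Λ → Fin (N + 1), (∏ x, m ^ (e x : ℕ) / ((e x : ℕ).factorial : ℂ)) *
        fermiBracketSU l Γ 0 (fun _ => (((∏ x, mesonC 1 x ^ (e x : ℕ) : Subalgebra.center ℂ (FermiAlg Λ N))) : FermiAlg Λ N)) := by
  have h1 : Finset.univ.noncommProd (fun x => grassmannExp ((0 : ℂ) • (meson x : FermiAlg Λ N)))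
      (fun x _ _ _ _ => commute_grassmannExp_smul_meson 0 x _) = 1 := by
    rw [Finset.noncommProd_eq_pow_card _ _ _ 1 fun x _ => by rw [zero_smul, grassmannExp, IsNilpotent.exp_zero],
      one_pow]
  rw [fermiZSU, fermiBracketSU_const l hl Γ m 1, one_mul, gaugeAverageSU_eq hN l hl Γ hΓ m,
    noncommProd_grassmannExp_smul_meson_eq_sum, Finset.sum_mul, map_sum]
  refine Finset.sum_congr rfl fun e _ => ?_
  rw [smul_mul_assoc, map_smul, smul_eq_mul, fermiBracketSU_const l hl Γ 0, gaugeAverageSU_eq hN l hl Γ hΓ 0, h1,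
    one_mul]

open scoped ComplexOrder in
/-- **NO SIGN PROBLEM AT `μ = 0` FOR ODD `N`**: for every real mass `m ≥ 0`, `σ_Λ Z(m) ≥ 0` — indeed
`σ_Λ Z(m)` is a sum over monomer numbers, partial dimer numbers and degree patterns of NONNEGATIVE terms
(`fermiZSU_eq_sum_monomer`, `fermiBracketSU_mesonPow_eq_sum_det_red`, `term_nonneg`), the baryon loops
of Fromm–de Forcrand (6) being resummed into determinants of real alternating matrices ((7): "for
`μ = 0` one recovers non-negative weights").  Honest framing: `β = 0`, one staggered flavour, `N` odd,
`Γ_b = ±1`, `m ≥ 0`; nothing about `μ ≠ 0` or `β > 0`. [cite: FrommForcrand2008, (6)–(7)] [cite: Cayley1849, pp. 93–96] -/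
theorem sgn_mul_fermiZSU_nonneg_of_nonneg (hN : Odd N) (l : B → Λ × Λ) (hl : ∀ b, (l b).1 ≠ (l b).2) (Γ : B → ℂ)
    (hΓ : ∀ b, Γ b = 1 ∨ Γ b = -1) {m : ℝ} (hm : 0 ≤ m) :
    0 ≤ sgn (Fintype.card (CIdx Λ N)) * fermiZSU (N := N) l Γ (m : ℂ) := by
  have hΓ2 : ∀ b, Γ b ^ 2 = 1 := fun b => by rcases hΓ b with h | h <;> simp [h]
  rw [fermiZSU_eq_sum_monomer hN.pos l hl Γ hΓ2 m, Finset.mul_sum]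
  refine Finset.sum_nonneg fun e _ => ?_
  rw [mul_left_comm]
  refine mul_nonneg ?_ (sgn_mul_fermiBracketSU_mesonPow_nonneg hN l hl Γ hΓ _)
  have hre : (∏ x, ((m : ℂ) ^ (e x : ℕ) / ((e x : ℕ).factorial : ℂ))) =
      ((∏ x, m ^ (e x : ℕ) / ((e x : ℕ).factorial : ℝ) : ℝ) : ℂ) := by
    push_cast; rfl
  rw [hre, Complex.zero_le_real]
  exact Finset.prod_nonneg fun x _ => by positivity

/-- **The monomer expansion with a mesonic observable**:
`∫ e^{-S_F(m)} ∏_x ψ̄ψ(x)^{e_x} = ∑_{e'} (∏_x m^{e'_x}/e'_x!) ∫ e^{-S_F(0)} ∏_x ψ̄ψ(x)^{e_x + e'_x}` (`N ≥ 1`). [cite: FrommForcrand2008, (4)–(6)] -/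
theorem fermiBracketSU_mesonPow_eq_sum_monomer (hN : 0 < N) (l : B → Λ × Λ) (hl : ∀ b, (l b).1 ≠ (l b).2)
    (Γ : B → ℂ) (hΓ : ∀ b, Γ b ^ 2 = 1) (m : ℂ) (e : Λ → ℕ) :
    fermiBracketSU l Γ m (fun _ => (((∏ x, mesonC 1 x ^ e x : Subalgebra.center ℂ (FermiAlg Λ N))) : FermiAlg Λ N)) =
      ∑ e' : Λ → Fin (N + 1), (∏ x, m ^ (e' x : ℕ) / ((e' x : ℕ).factorial : ℂ)) *
        fermiBracketSU l Γ 0 (fun _ => (((∏ x, mesonC 1 x ^ (e x + (e' x : ℕ)) :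
          Subalgebra.center ℂ (FermiAlg Λ N))) : FermiAlg Λ N)) := by
  have h1 : Finset.univ.noncommProd (fun x => grassmannExp ((0 : ℂ) • (meson x : FermiAlg Λ N)))
      (fun x _ _ _ _ => commute_grassmannExp_smul_meson 0 x _) = 1 := by
    rw [Finset.noncommProd_eq_pow_card _ _ _ 1 fun x _ => by rw [zero_smul, grassmannExp, IsNilpotent.exp_zero],
      one_pow]
  have hOBS : ∀ e' : Λ → Fin (N + 1), ((∏ x, mesonC 1 x ^ e x) * ∏ x, mesonC 1 x ^ (e' x : ℕ) :
      Subalgebra.center ℂ (FermiAlg Λ N)) = ∏ x, mesonC 1 x ^ (e x + (e' x : ℕ)) := fun e' => by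
    rw [← Finset.prod_mul_distrib]
    exact Finset.prod_congr rfl fun x _ => (pow_add _ _ _).symm
  rw [fermiBracketSU_const l hl Γ m, gaugeAverageSU_eq hN l hl Γ hΓ m, noncommProd_grassmannExp_smul_meson_eq_sum,
    Finset.sum_mul, Finset.mul_sum, map_sum]
  refine Finset.sum_congr rfl fun e' _ => ?_
  rw [smul_mul_assoc, mul_smul_comm, map_smul, ← mul_assoc, ← Subalgebra.coe_mul, hOBS e', smul_eq_mul,
    fermiBracketSU_const l hl Γ 0, gaugeAverageSU_eq hN l hl Γ hΓ 0, h1, one_mul]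

open scoped ComplexOrder in
/-- **POSITIVITY OF ALL MESONIC MOMENTS AT REAL MASS `m ≥ 0`** (`N` odd, `Γ_b = ±1`):
`σ_Λ ∫ e^{-S_F(m)} ∏_x ψ̄ψ(x)^{e_x} ≥ 0`. [cite: FrommForcrand2008, (6)–(7)] [cite: Cayley1849, pp. 93–96] -/
theorem sgn_mul_fermiBracketSU_mesonPow_nonneg_of_nonneg (hN : Odd N) (l : B → Λ × Λ) (hl : ∀ b, (l b).1 ≠ (l b).2)
    (Γ : B → ℂ) (hΓ : ∀ b, Γ b = 1 ∨ Γ b = -1) {m : ℝ} (hm : 0 ≤ m) (e : Λ → ℕ) :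
    0 ≤ sgn (Fintype.card (CIdx Λ N)) *
      fermiBracketSU l Γ (m : ℂ) (fun _ => (((∏ x, mesonC 1 x ^ e x : Subalgebra.center ℂ (FermiAlg Λ N))) : FermiAlg Λ N)) := by
  have hΓ2 : ∀ b, Γ b ^ 2 = 1 := fun b => by rcases hΓ b with h | h <;> simp [h]
  rw [fermiBracketSU_mesonPow_eq_sum_monomer hN.pos l hl Γ hΓ2 m e, Finset.mul_sum]
  refine Finset.sum_nonneg fun e' _ => ?_
  rw [mul_left_comm]
  refine mul_nonneg ?_ (sgn_mul_fermiBracketSU_mesonPow_nonneg hN l hl Γ hΓ _)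
  have hre : (∏ x, ((m : ℂ) ^ (e' x : ℕ) / ((e' x : ℕ).factorial : ℂ))) =
      ((∏ x, m ^ (e' x : ℕ) / ((e' x : ℕ).factorial : ℝ) : ℝ) : ℂ) := by
    push_cast; rfl
  rw [hre, Complex.zero_le_real]
  exact Finset.prod_nonneg fun x _ => by positivity

open scoped ComplexOrder in
omit [LinearOrder Λ] [Fintype Λ] [Fintype B] [DecidableEq B] in
/-- A quotient of nonnegative (hence real) complex numbers is nonnegative. [cite: Berezin1966, Ch. I §3 (3.5)] -/
private theorem div_nonneg_complex {a b : ℂ} (ha : 0 ≤ a) (hb : 0 ≤ b) : 0 ≤ a / b := by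
  obtain ⟨ha1, ha2⟩ := Complex.nonneg_iff.1 ha
  obtain ⟨hb1, hb2⟩ := Complex.nonneg_iff.1 hb
  have ha' : a = ((a.re : ℝ) : ℂ) := Complex.ext (by simp) (by simp [← ha2])
  have hb' : b = ((b.re : ℝ) : ℂ) := Complex.ext (by simp) (by simp [← hb2])
  rw [ha', hb', ← Complex.ofReal_div, Complex.zero_le_real]
  exact div_nonneg ha1 hb1

open scoped ComplexOrder in
/-- **GRIFFITHS-TYPE POSITIVITY OF THE MESONIC EXPECTATIONS** (`β = 0`, `G = SU(N)` with `N` odd, one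
staggered flavour, `Γ_b = ±1`, real mass `m ≥ 0`): `⟨∏_x (ψ̄ψ(x))^{e_x}⟩_{Λ,m} ≥ 0` for every `e : Λ → ℕ` —
numerator and partition function are, up to the common orientation sign `σ_Λ`, sums of nonnegative terms
(junk value `0` if `Z = 0`).  In particular the finite-volume chiral condensate `⟨ψ̄ψ(x)⟩_{Λ,m}` and the
correlations `⟨ψ̄ψ(x) ψ̄ψ(y)⟩_{Λ,m}` are `≥ 0`.  Honest framing: finite volume, `β = 0`, `N` odd; nothing
about `β > 0`, even `N`, `μ ≠ 0` or the thermodynamic limit. [cite: FrommForcrand2008, (6)–(7)] [cite: Cayley1849, pp. 93–96] -/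
theorem fermiExpectSU_mesonPow_nonneg (hN : Odd N) (l : B → Λ × Λ) (hl : ∀ b, (l b).1 ≠ (l b).2) (Γ : B → ℂ)
    (hΓ : ∀ b, Γ b = 1 ∨ Γ b = -1) {m : ℝ} (hm : 0 ≤ m) (e : Λ → ℕ) :
    0 ≤ fermiExpectSU l Γ (m : ℂ) (fun _ => (((∏ x, mesonC 1 x ^ e x : Subalgebra.center ℂ (FermiAlg Λ N))) : FermiAlg Λ N)) := by
  rw [fermiExpectSU, ← mul_div_mul_left _ _ (sgn_ne_zero (Fintype.card (CIdx Λ N)))]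
  exact div_nonneg_complex (sgn_mul_fermiBracketSU_mesonPow_nonneg_of_nonneg hN l hl Γ hΓ hm e)
    (sgn_mul_fermiZSU_nonneg_of_nonneg hN l hl Γ hΓ hm)

/-! ### Stage B8: strict positivity of `Z(m)` for `m > 0` -/

omit [Fintype Λ] [DecidableEq B] in
/-- The empty configuration has no dimers at any site. [cite: FrommForcrand2008, (6)] -/
theorem siteDeg_zero (hN : 0 < N) (l : B → Λ × Λ) (x : Λ) : siteDeg l (fun _ => (⟨0, hN⟩ : Fin N)) x = 0 := by
  simp [siteDeg]

open scoped ComplexOrder in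
/-- **The all-monomer configuration**: `σ_Λ ∫ e^{-S_F}|_{m=0} ∏_x ψ̄ψ(x)^N ≥ (N!)^{|Λ|}` (in fact `=`: every
site saturated by monomers, no dimer, no baryon; the bound is what positivity needs). [cite: FrommForcrand2008, (6)] -/
theorem le_sgn_mul_fermiBracketSU_mesonTop (hN : Odd N) (l : B → Λ × Λ) (hl : ∀ b, (l b).1 ≠ (l b).2) (Γ : B → ℂ)
    (hΓ : ∀ b, Γ b = 1 ∨ Γ b = -1) :
    ((N.factorial : ℂ) ^ Fintype.card Λ) ≤ sgn (Fintype.card (CIdx Λ N)) *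
      fermiBracketSU l Γ 0 (fun _ => (((∏ x, mesonC 1 x ^ N : Subalgebra.center ℂ (FermiAlg Λ N))) : FermiAlg Λ N)) := by
  have hΓ2 : ∀ b, Γ b ^ 2 = 1 := fun b => by rcases hΓ b with h | h <;> simp [h]
  have hgoal : (fun _ : B → OneLink.SUN N => (((∏ x, mesonC 1 x ^ N : Subalgebra.center ℂ (FermiAlg Λ N))) : FermiAlg Λ N)) =
      fun _ => (((∏ x, mesonC 1 x ^ (fun _ : Λ => N) x : Subalgebra.center ℂ (FermiAlg Λ N))) : FermiAlg Λ N) := rfl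
  rw [hgoal]
  set eTop : Λ → ℕ := fun _ => N with heTop
  clear_value eTop
  have h := fermiBracketSU_mesonPow_eq_sum_det_red hN l hl Γ hΓ2 eTop
  rw [h, ← mul_assoc, ← mul_assoc, sgn_mul_self, one_mul]
  set n0 : B → Fin N := fun _ => ⟨0, hN.pos⟩ with hn0
  clear_value n0
  have hD0 : siteDeg l n0 + eTop = eTop := funext fun x => by
    rw [Pi.add_apply, hn0, siteDeg_zero hN.pos l x, zero_add]
  have hNe : ∀ x, eTop x = N := fun x => by rw [heTop]
  let T : (B → Fin N) → ℂ := fun n =>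
    if (∀ x, (siteDeg l n + eTop) x = 0 ∨ (siteDeg l n + eTop) x = N) then
      (∏ b, dimerCoeff N (n b)) *
        ((N.factorial : ℂ)⁻¹ ^ Fintype.card (Free (siteDeg l n + eTop)) * (Kred N l Γ (siteDeg l n + eTop)).det)
    else 0
  have hTnn : ∀ n, 0 ≤ T n := fun n => by
    dsimp only [T]
    split_ifs
    · exact term_nonneg hN l Γ hΓ n _
    · exact le_rfl
  have h0 : T n0 = 1 := by
    dsimp only [T]
    rw [if_pos fun x => Or.inr (by rw [hD0, hNe]), hD0]
    haveI : IsEmpty (Free eTop) := ⟨fun u => hN.pos.ne' (by rw [← hNe u.1]; exact u.2)⟩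
    rw [Matrix.det_isEmpty, Fintype.card_eq_zero, pow_zero, mul_one, mul_one]
    exact Finset.prod_eq_one fun b _ => by rw [hn0]; exact dimerCoeff_zero
  have hterm : (1 : ℂ) ≤ ∑ n, T n := by
    have := Finset.single_le_sum (fun n _ => hTnn n) (Finset.mem_univ n0)
    rwa [h0] at this
  show ((N.factorial : ℂ) ^ Fintype.card Λ) ≤ (N.factorial : ℂ) ^ Fintype.card Λ * ∑ n, T n
  calc ((N.factorial : ℂ) ^ Fintype.card Λ) = (N.factorial : ℂ) ^ Fintype.card Λ * 1 := (mul_one _).symm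
    _ ≤ _ := mul_le_mul_of_nonneg_left hterm (pow_nonneg (Nat.cast_nonneg _) _)

open scoped ComplexOrder in
/-- **`Z(m) > 0` FOR `m > 0`** (`N` odd, `Γ_b = ±1`): `σ_Λ Z(m) ≥ (m^N)^{|Λ|} > 0` — the all-monomer term of
the monomer expansion, all other terms being `≥ 0`; hence the expectations `⟨·⟩_{Λ,m} = Z⁻¹∫` are genuine
quotients for every `m > 0`. [cite: FrommForcrand2008, (6)–(7)] [cite: Cayley1849, pp. 93–96] -/
theorem sgn_mul_fermiZSU_pos (hN : Odd N) (l : B → Λ × Λ) (hl : ∀ b, (l b).1 ≠ (l b).2) (Γ : B → ℂ)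
    (hΓ : ∀ b, Γ b = 1 ∨ Γ b = -1) {m : ℝ} (hm : 0 < m) :
    0 < sgn (Fintype.card (CIdx Λ N)) * fermiZSU (N := N) l Γ (m : ℂ) := by
  have hΓ2 : ∀ b, Γ b ^ 2 = 1 := fun b => by rcases hΓ b with h | h <;> simp [h]
  rw [fermiZSU_eq_sum_monomer hN.pos l hl Γ hΓ2 m, Finset.mul_sum]
  set eN : Λ → Fin (N + 1) := fun _ => ⟨N, Nat.lt_succ_self N⟩ with heN
  have hnonneg : ∀ e ∈ (Finset.univ : Finset (Λ → Fin (N + 1))),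
      (0 : ℂ) ≤ sgn (Fintype.card (CIdx Λ N)) * ((∏ x, (m : ℂ) ^ (e x : ℕ) / ((e x : ℕ).factorial : ℂ)) *
        fermiBracketSU l Γ 0 (fun _ => (((∏ x, mesonC 1 x ^ (e x : ℕ) : Subalgebra.center ℂ (FermiAlg Λ N))) :
          FermiAlg Λ N))) := by
    intro e _
    rw [mul_left_comm]
    refine mul_nonneg ?_ (sgn_mul_fermiBracketSU_mesonPow_nonneg hN l hl Γ hΓ _)
    have hre : (∏ x, ((m : ℂ) ^ (e x : ℕ) / ((e x : ℕ).factorial : ℂ))) =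
        ((∏ x, m ^ (e x : ℕ) / ((e x : ℕ).factorial : ℝ) : ℝ) : ℂ) := by
      push_cast; rfl
    rw [hre, Complex.zero_le_real]
    exact Finset.prod_nonneg fun x _ => by positivity
  refine lt_of_lt_of_le ?_ (Finset.single_le_sum hnonneg (Finset.mem_univ eN))
  rw [mul_left_comm]
  have hc : (0 : ℂ) < ∏ x, (m : ℂ) ^ (eN x : ℕ) / ((eN x : ℕ).factorial : ℂ) := by
    have hre : (∏ x, ((m : ℂ) ^ (eN x : ℕ) / ((eN x : ℕ).factorial : ℂ))) =
        ((∏ x, m ^ (eN x : ℕ) / ((eN x : ℕ).factorial : ℝ) : ℝ) : ℂ) := by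
      push_cast; rfl
    rw [hre, Complex.zero_lt_real]
    exact Finset.prod_pos fun x _ => by positivity
  refine mul_pos hc (lt_of_lt_of_le ?_ (le_sgn_mul_fermiBracketSU_mesonTop hN l hl Γ hΓ))
  exact pow_pos (Nat.cast_pos.2 (Nat.factorial_pos N)) _

open scoped ComplexOrder in
/-- **`Z(m) ≠ 0` for `m > 0`** (`N` odd, `Γ_b = ±1`). [cite: FrommForcrand2008, (6)–(7)] -/
theorem fermiZSU_ne_zero_of_pos (hN : Odd N) (l : B → Λ × Λ) (hl : ∀ b, (l b).1 ≠ (l b).2) (Γ : B → ℂ)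
    (hΓ : ∀ b, Γ b = 1 ∨ Γ b = -1) {m : ℝ} (hm : 0 < m) : fermiZSU (N := N) l Γ (m : ℂ) ≠ 0 := by
  intro h
  have := sgn_mul_fermiZSU_pos hN l hl Γ hΓ hm
  rw [h, mul_zero] at this
  exact lt_irrefl _ this

end Monomers

/-! ### Stage B9: bookkeeping for the Schwinger–Dyson comparison (adding one dimer on a bond) -/

section BondShift

variable {Λ : Type*} [LinearOrder Λ] [Fintype Λ] {N : ℕ}
variable {B : Type*} [Fintype B] [DecidableEq B]

/-- **The dimer-coefficient recursion** `c_j = 4 (j+1)(N-j) c_{j+1}` (`j < N`), i.e.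
`α_j/α_{j+1} = (j+1)(N-j)` for `α_j = (N-j)!/(N! j!)`. [cite: FrommForcrand2008, (5)] -/
theorem dimerCoeff_eq_mul_succ {j : ℕ} (hj : j < N) :
    dimerCoeff N j = 4 * ((j : ℂ) + 1) * ((N : ℂ) - j) * dimerCoeff N (j + 1) := by
  have hNj : N - j = (N - (j + 1)) + 1 := by omega
  rw [dimerCoeff, dimerCoeff, hNj, Nat.factorial_succ, Nat.factorial_succ j]
  have hsub : (((N - (j + 1) : ℕ) : ℂ) + 1) = (N : ℂ) - j := by
    rw [Nat.cast_sub (by omega : j + 1 ≤ N)]; push_cast; ring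
  have hf1 : ((N.factorial : ℂ)) ≠ 0 := Nat.cast_ne_zero.2 (Nat.factorial_ne_zero N)
  have hf2 : ((j.factorial : ℂ)) ≠ 0 := Nat.cast_ne_zero.2 (Nat.factorial_ne_zero j)
  have hf3 : (((N - (j + 1)).factorial : ℂ)) ≠ 0 := Nat.cast_ne_zero.2 (Nat.factorial_ne_zero _)
  have hj1 : ((j : ℂ) + 1) ≠ 0 := by exact_mod_cast Nat.succ_ne_zero j
  push_cast
  rw [hsub]
  field_simp
  ring

/-- Adding one dimer on the bond `b` (when `n_b + 1 < N`). [cite: FrommForcrand2008, (6)] -/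
def addDimer (n : B → Fin N) (b : B) (h : (n b : ℕ) + 1 < N) : B → Fin N :=
  Function.update n b ⟨(n b : ℕ) + 1, h⟩

omit [Fintype B] in
/-- The value of `addDimer` on the shifted bond. [cite: FrommForcrand2008, (6)] -/
@[simp] theorem addDimer_apply_self (n : B → Fin N) (b : B) (h : (n b : ℕ) + 1 < N) :
    ((addDimer n b h b : Fin N) : ℕ) = (n b : ℕ) + 1 := by
  rw [addDimer, Function.update_self]

omit [Fintype B] in
/-- The value of `addDimer` off the shifted bond. [cite: FrommForcrand2008, (6)] -/
@[simp] theorem addDimer_apply_of_ne (n : B → Fin N) (b : B) (h : (n b : ℕ) + 1 < N) {b' : B} (hb' : b' ≠ b) :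
    addDimer n b h b' = n b' := by
  rw [addDimer, Function.update_of_ne hb']

omit [Fintype Λ] in
/-- **Adding a dimer on `b = (x_b, y_b)` raises the site degrees of `x_b` and `y_b` by one**:
`d_{n + δ_b}(x) = d_n(x) + [x = x_b] + [x = y_b]`. [cite: FrommForcrand2008, (6)] -/
theorem siteDeg_addDimer (l : B → Λ × Λ) (n : B → Fin N) (b : B) (h : (n b : ℕ) + 1 < N) (x : Λ) :
    siteDeg l (addDimer n b h) x =
      siteDeg l n x + (if (l b).1 = x then 1 else 0) + (if (l b).2 = x then 1 else 0) := by
  have key : ∀ (p : B → Prop) [DecidablePred p],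
      ∑ b' ∈ Finset.univ.filter p, ((addDimer n b h b' : Fin N) : ℕ) =
        (∑ b' ∈ Finset.univ.filter p, (n b' : ℕ)) + (if p b then 1 else 0) := by
    intro p _
    by_cases hp : p b
    · have hmem : b ∈ Finset.univ.filter p := Finset.mem_filter.2 ⟨Finset.mem_univ _, hp⟩
      rw [← Finset.add_sum_erase _ _ hmem, ← Finset.add_sum_erase _ _ hmem, if_pos hp, addDimer_apply_self,
        Finset.sum_congr rfl fun b' hb' => by rw [addDimer_apply_of_ne n b h (Finset.ne_of_mem_erase hb')]]
      ring
    · rw [if_neg hp, add_zero]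
      exact Finset.sum_congr rfl fun b' hb' => by
        rw [addDimer_apply_of_ne n b h (fun hb => hp (hb ▸ (Finset.mem_filter.1 hb').2))]
  rw [siteDeg, siteDeg, key (fun b' => (l b').1 = x), key (fun b' => (l b').2 = x)]
  ring

omit [Fintype Λ] [LinearOrder Λ] in
/-- **The weight of the shifted configuration**: `w(n) = 4 (n_b+1)(N-n_b) · w(n + δ_b)`,
`w = ∏_b c_{n_b}`. [cite: FrommForcrand2008, (5)–(6)] -/
theorem prod_dimerCoeff_eq_mul_addDimer (n : B → Fin N) (b : B) (h : (n b : ℕ) + 1 < N) :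
    ∏ b', dimerCoeff N (n b' : ℕ) =
      4 * (((n b : ℕ) : ℂ) + 1) * ((N : ℂ) - (n b : ℕ)) * ∏ b', dimerCoeff N (addDimer n b h b' : ℕ) := by
  have hrest : ∏ b' ∈ Finset.univ.erase b, dimerCoeff N (addDimer n b h b' : ℕ) =
      ∏ b' ∈ Finset.univ.erase b, dimerCoeff N (n b' : ℕ) :=
    Finset.prod_congr rfl fun b' hb' => by rw [addDimer_apply_of_ne n b h (Finset.ne_of_mem_erase hb')]
  rw [← Finset.mul_prod_erase Finset.univ (fun b' => dimerCoeff N (n b' : ℕ)) (Finset.mem_univ b),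
    ← Finset.mul_prod_erase Finset.univ (fun b' => dimerCoeff N (addDimer n b h b' : ℕ)) (Finset.mem_univ b), hrest,
    addDimer_apply_self, dimerCoeff_eq_mul_succ (by omega : (n b : ℕ) < N)]
  ring

/-- Removing one dimer from the bond `b` (when `n_b ≥ 1`). [cite: FrommForcrand2008, (6)] -/
def removeDimer (n : B → Fin N) (b : B) : B → Fin N :=
  Function.update n b ⟨(n b : ℕ) - 1, lt_of_le_of_lt (Nat.sub_le _ _) (n b).2⟩

omit [Fintype B] in
/-- `removeDimer` then `addDimer` is the identity when `n_b ≥ 1`. [cite: FrommForcrand2008, (6)] -/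
theorem addDimer_removeDimer (n : B → Fin N) (b : B) (h1 : 1 ≤ (n b : ℕ))
    (h : ((removeDimer n b b : Fin N) : ℕ) + 1 < N) : addDimer (removeDimer n b) b h = n := by
  funext b'
  by_cases hb' : b' = b
  · subst hb'
    apply Fin.ext
    rw [addDimer_apply_self, removeDimer, Function.update_self]
    dsimp only
    omega
  · rw [addDimer_apply_of_ne _ _ _ hb', removeDimer, Function.update_of_ne hb']

omit [Fintype B] in
/-- `addDimer` then `removeDimer` is the identity. [cite: FrommForcrand2008, (6)] -/
theorem removeDimer_addDimer (n : B → Fin N) (b : B) (h : (n b : ℕ) + 1 < N) : removeDimer (addDimer n b h) b = n := by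
  funext b'
  by_cases hb' : b' = b
  · subst hb'
    apply Fin.ext
    rw [removeDimer, Function.update_self]
    dsimp only
    rw [addDimer_apply_self]
    omega
  · rw [removeDimer, Function.update_of_ne hb', addDimer_apply_of_ne _ _ _ hb']

/-- **Re-indexing by one dimer on `b`**: summing `Φ` over the configurations with `n_b ≥ 1` is summing
`Φ(n + δ_b)` over those with `n_b + 1 < N`. [cite: FrommForcrand2008, (6)] -/
theorem sum_filter_one_le_eq_sum_addDimer {M : Type*} [AddCommMonoid M] (b : B) (Φ : (B → Fin N) → M) :
    ∑ n ∈ Finset.univ.filter (fun n : B → Fin N => 1 ≤ (n b : ℕ)), Φ n =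
      ∑ n ∈ Finset.univ.filter (fun n : B → Fin N => (n b : ℕ) + 1 < N),
        if h : (n b : ℕ) + 1 < N then Φ (addDimer n b h) else 0 := by
  symm
  refine Finset.sum_bij' (fun n hn => addDimer n b (Finset.mem_filter.1 hn).2) (fun n _ => removeDimer n b)
    (fun n hn => ?_) (fun n hn => ?_) (fun n hn => ?_) (fun n hn => ?_) (fun n hn => ?_)
  · exact Finset.mem_filter.2 ⟨Finset.mem_univ _, by rw [addDimer_apply_self]; omega⟩
  · refine Finset.mem_filter.2 ⟨Finset.mem_univ _, ?_⟩
    have h1 := (Finset.mem_filter.1 hn).2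
    have h2 := (n b).2
    rw [removeDimer, Function.update_self]
    dsimp only
    omega
  · exact removeDimer_addDimer n b _
  · exact addDimer_removeDimer n b (Finset.mem_filter.1 hn).2 _
  · rw [dif_pos (Finset.mem_filter.1 hn).2]

end BondShift

/-! ### Stage B10: the Schwinger–Dyson lower bound modulo the baryonic sites -/

section SchwingerDyson

variable {Λ : Type*} [LinearOrder Λ] [Fintype Λ] {N : ℕ}
variable {B : Type*} [Fintype B] [DecidableEq B]

/-- The degree pattern of the bond observable `ψ̄ψ(x_b) ψ̄ψ(y_b)`: one monomer at each endpoint. [cite: FrommForcrand2008, (6)] -/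
def bondObs (l : B → Λ × Λ) (b : B) : Λ → ℕ := fun x => (if (l b).1 = x then 1 else 0) + (if (l b).2 = x then 1 else 0)

omit [Fintype B] [DecidableEq B] in
/-- `∏_x ψ̄ψ(x)^{[x = x_b] + [x = y_b]} = ψ̄ψ(x_b) ψ̄ψ(y_b)`. [cite: FrommForcrand2008, (6)] -/
theorem prod_mesonC_pow_bondObs (l : B → Λ × Λ) (b : B) :
    (∏ x, mesonC 1 x ^ bondObs l b x : Subalgebra.center ℂ (FermiAlg Λ N)) = mesonC 1 (l b).1 * mesonC 1 (l b).2 := by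
  have h : ∀ u : Λ, (∏ x, mesonC 1 x ^ (if u = x then 1 else 0) : Subalgebra.center ℂ (FermiAlg Λ N)) = mesonC 1 u := by
    intro u
    rw [Finset.prod_congr rfl fun x _ => show (mesonC 1 x ^ (if u = x then 1 else 0) : Subalgebra.center ℂ (FermiAlg Λ N)) =
        if u = x then mesonC 1 x else 1 by split_ifs <;> simp, Finset.prod_ite_eq, if_pos (Finset.mem_univ u)]
  simp only [bondObs, pow_add, Finset.prod_mul_distrib, h]

omit [Fintype Λ] in
/-- Adding a dimer on `b` adds the bond pattern to the site degrees. [cite: FrommForcrand2008, (6)] -/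
theorem siteDeg_addDimer_eq (l : B → Λ × Λ) (n : B → Fin N) (b : B) (h : (n b : ℕ) + 1 < N) :
    siteDeg l (addDimer n b h) = siteDeg l n + bondObs l b :=
  funext fun x => by rw [siteDeg_addDimer, Pi.add_apply, bondObs, add_assoc]

variable (N) in
/-- **The weight of a partial-dimer configuration in `σ_Λ Z / (N!)^{|Λ|}`**:
`W(n) = (∏_b c_{n_b}) (N!)^{-|S(n)|} det K̃_{S(n)}` (the summand of `fermiZSU_eq_sum_det_red`). [cite: FrommForcrand2008, (6)] -/
def zWeight (l : B → Λ × Λ) (Γ : B → ℂ) (n : B → Fin N) : ℂ :=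
  (∏ b, dimerCoeff N (n b)) *
    ((N.factorial : ℂ)⁻¹ ^ Fintype.card (Free (siteDeg l n)) * (Kred N l Γ (siteDeg l n)).det)

omit [DecidableEq B] in
open scoped ComplexOrder in
/-- The weights are nonnegative (`N` odd, `Γ_b = ±1`). [cite: FrommForcrand2008, (6)–(7)] [cite: Cayley1849, pp. 93–96] -/
theorem zWeight_nonneg (hN : Odd N) (l : B → Λ × Λ) (Γ : B → ℂ) (hΓ : ∀ b, Γ b = 1 ∨ Γ b = -1) (n : B → Fin N) :
    0 ≤ zWeight N l Γ n :=
  term_nonneg hN l Γ hΓ n _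

open scoped ComplexOrder in
/-- **THE SCHWINGER–DYSON COMPARISON ON ONE BOND** (`N` odd, `Γ_b = ±1`, distinct endpoints): for every
link `b`,
`σ_Λ ∫ e^{-S_F}|_{m=0} ψ̄ψ(x_b)ψ̄ψ(y_b) ≥ (N!)^{|Λ|} ∑_{n admissible} 4 n_b (N+1-n_b) W(n)`
— the configurations of the two-point function with `n_b ≤ N-2` are those of `Z` with one dimer added on
`b` (`w(n) = 4(n_b+1)(N-n_b) w(n+δ_b)`), and the remaining ones (`n_b = N-1`, the `N`-fold dimer) are
`≥ 0`. [cite: FrommForcrand2008, (5)–(6)] [cite: SalmhoferSeiler1991, §3 (3.44)–(3.46) & Lemma 4.7 (4.38)] -/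
theorem sd_bond_lower_bound (hN : Odd N) (l : B → Λ × Λ) (hl : ∀ b, (l b).1 ≠ (l b).2) (Γ : B → ℂ)
    (hΓ : ∀ b, Γ b = 1 ∨ Γ b = -1) (b : B) :
    (N.factorial : ℂ) ^ Fintype.card Λ *
        ∑ n : B → Fin N, (if (∀ x, siteDeg l n x = 0 ∨ siteDeg l n x = N) then
          (4 * ((n b : ℕ) : ℂ) * ((N : ℂ) + 1 - (n b : ℕ))) * zWeight N l Γ n else 0) ≤
      sgn (Fintype.card (CIdx Λ N)) * fermiBracketSU l Γ 0 (fun _ => (meson (l b).1 * meson (l b).2 : FermiAlg Λ N)) := by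
  have hΓ2 : ∀ b, Γ b ^ 2 = 1 := fun b => by rcases hΓ b with h | h <;> simp [h]
  have hobs : (fun _ : B → OneLink.SUN N => (meson (l b).1 * meson (l b).2 : FermiAlg Λ N)) =
      fun _ => (((∏ x, mesonC 1 x ^ bondObs l b x : Subalgebra.center ℂ (FermiAlg Λ N))) : FermiAlg Λ N) :=
    funext fun _ => by rw [prod_mesonC_pow_bondObs, Subalgebra.coe_mul, coe_mesonC, coe_mesonC, one_smul, one_smul]
  rw [hobs, fermiBracketSU_mesonPow_eq_sum_det_red hN l hl Γ hΓ2 (bondObs l b), ← mul_assoc, ← mul_assoc, sgn_mul_self,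
    one_mul]
  refine mul_le_mul_of_nonneg_left ?_ (pow_nonneg (Nat.cast_nonneg _) _)
  -- the summands
  set Ψ : (B → Fin N) → ℂ := fun n => if (∀ x, siteDeg l n x = 0 ∨ siteDeg l n x = N) then
      (4 * ((n b : ℕ) : ℂ) * ((N : ℂ) + 1 - (n b : ℕ))) * zWeight N l Γ n else 0 with hΨ
  set Φ : (B → Fin N) → ℂ := fun n => if (∀ x, (siteDeg l n + bondObs l b) x = 0 ∨ (siteDeg l n + bondObs l b) x = N) then
      (∏ b', dimerCoeff N (n b')) *
        ((N.factorial : ℂ)⁻¹ ^ Fintype.card (Free (siteDeg l n + bondObs l b)) *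
          (Kred N l Γ (siteDeg l n + bondObs l b)).det) else 0 with hΦ
  have hΦnn : ∀ n, 0 ≤ Φ n := fun n => by
    rw [hΦ]; dsimp only
    split_ifs
    · exact term_nonneg hN l Γ hΓ n _
    · exact le_rfl
  have hΨ0 : ∀ n : B → Fin N, ¬(1 ≤ (n b : ℕ)) → Ψ n = 0 := fun n hnb => by
    have h0 : (n b : ℕ) = 0 := by omega
    rw [hΨ]; dsimp only
    rw [h0, Nat.cast_zero, mul_zero, zero_mul, zero_mul, ite_self]
  have hshift : ∀ (n : B → Fin N) (h : (n b : ℕ) + 1 < N), Ψ (addDimer n b h) = Φ n := by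
    intro n h
    rw [hΨ, hΦ]; dsimp only
    rw [zWeight, siteDeg_addDimer_eq, prod_dimerCoeff_eq_mul_addDimer n b h, addDimer_apply_self]
    split_ifs
    · push_cast; ring
    · rfl
  calc ∑ n, Ψ n = ∑ n ∈ Finset.univ.filter (fun n : B → Fin N => 1 ≤ (n b : ℕ)), Ψ n :=
        (Finset.sum_filter_of_ne fun n _ hne => by by_contra hlt; exact hne (hΨ0 n hlt)).symm
    _ = ∑ n ∈ Finset.univ.filter (fun n : B → Fin N => (n b : ℕ) + 1 < N),
          if h : (n b : ℕ) + 1 < N then Ψ (addDimer n b h) else 0 := sum_filter_one_le_eq_sum_addDimer b Ψ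
    _ = ∑ n ∈ Finset.univ.filter (fun n : B → Fin N => (n b : ℕ) + 1 < N), Φ n :=
        Finset.sum_congr rfl fun n hn => by rw [dif_pos (Finset.mem_filter.1 hn).2, hshift]
    _ ≤ ∑ n, Φ n := Finset.sum_le_sum_of_subset_of_nonneg (Finset.filter_subset _ _) fun n _ _ => hΦnn n

omit [Fintype Λ] in
/-- The dimer degree at `x` is the sum of the dimer numbers over the links at `x` (distinct endpoints). [cite: FrommForcrand2008, (6)] -/
theorem siteDeg_eq_sum_filter (l : B → Λ × Λ) (hl : ∀ b, (l b).1 ≠ (l b).2) (n : B → Fin N) (x : Λ) :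
    siteDeg l n x = ∑ b ∈ Finset.univ.filter (fun b => (l b).1 = x ∨ (l b).2 = x), (n b : ℕ) := by
  rw [siteDeg, Finset.filter_or, Finset.sum_union]
  exact Finset.disjoint_filter.2 fun b _ h1 h2 => hl b (h1.trans h2.symm)

open scoped ComplexOrder in
/-- **THE SCHWINGER–DYSON LOWER BOUND MODULO THE BARYONIC SITES** (`β = 0`, `m = 0`, `G = SU(N)` with
`N` odd, `Γ_b = ±1`, distinct endpoints): for every site `x`,
`∑_{b ∋ x} σ_Λ ∫ e^{-S_F} ψ̄ψ(x_b)ψ̄ψ(y_b) ≥ 8N · (N!)^{|Λ|} ∑_{n admissible, x ∈ V(n)} W(n) = 8N · σ_Λ (Z - Z_S(x))`,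
`Z_S(x)` the part of `Z = σ_Λ(N!)^{|Λ|} ∑_n W(n)` (`fermiZSU_eq_sum_det_red`) from the configurations in
which `x` is untouched by dimers (a baryonic site): the mesonic Schwinger–Dyson bound of Salmhofer–Seiler
holds for `SU(N)` up to the probability that `x` lies on a baryon loop. [cite: SalmhoferSeiler1991, §3 (3.44)–(3.46) & Lemma 4.7 (4.38)] [cite: FrommForcrand2008, (5)–(6)] -/
theorem sd_site_lower_bound (hN : Odd N) (l : B → Λ × Λ) (hl : ∀ b, (l b).1 ≠ (l b).2) (Γ : B → ℂ)
    (hΓ : ∀ b, Γ b = 1 ∨ Γ b = -1) (x : Λ) :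
    8 * (N : ℂ) * ((N.factorial : ℂ) ^ Fintype.card Λ *
        ∑ n : B → Fin N, (if (∀ x', siteDeg l n x' = 0 ∨ siteDeg l n x' = N) ∧ siteDeg l n x = N then zWeight N l Γ n else 0)) ≤
      ∑ b ∈ Finset.univ.filter (fun b => (l b).1 = x ∨ (l b).2 = x),
        sgn (Fintype.card (CIdx Λ N)) * fermiBracketSU l Γ 0 (fun _ => (meson (l b).1 * meson (l b).2 : FermiAlg Λ N)) := by
  set nbr := Finset.univ.filter (fun b => (l b).1 = x ∨ (l b).2 = x) with hnbr
  refine le_trans ?_ (Finset.sum_le_sum fun b _ => sd_bond_lower_bound hN l hl Γ hΓ b)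
  set F : ℂ := (N.factorial : ℂ) ^ Fintype.card Λ with hF
  have hFnn : 0 ≤ F := pow_nonneg (Nat.cast_nonneg _) _
  -- the bond coefficients `4 n_b (N + 1 - n_b)` are `≥ 8 n_b` and nonnegative
  have hcoef : ∀ (n : B → Fin N) (b : B), ((N : ℂ) + 1 - (n b : ℕ)) = (((N + 1 - (n b : ℕ) : ℕ)) : ℂ) := fun n b => by
    rw [Nat.cast_sub (by have := (n b).2; omega)]; push_cast; ring
  have hfnn : ∀ (n : B → Fin N) (b : B), (0 : ℂ) ≤ 4 * ((n b : ℕ) : ℂ) * ((N : ℂ) + 1 - (n b : ℕ)) := fun n b => by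
    rw [hcoef]; exact mul_nonneg (mul_nonneg (by norm_num) (Nat.cast_nonneg _)) (Nat.cast_nonneg _)
  have hL : 8 * (N : ℂ) * (F * ∑ n : B → Fin N,
      (if (∀ x', siteDeg l n x' = 0 ∨ siteDeg l n x' = N) ∧ siteDeg l n x = N then zWeight N l Γ n else 0)) =
      ∑ n : B → Fin N, 8 * (N : ℂ) * (F *
        (if (∀ x', siteDeg l n x' = 0 ∨ siteDeg l n x' = N) ∧ siteDeg l n x = N then zWeight N l Γ n else 0)) := by
    rw [Finset.mul_sum, Finset.mul_sum]
  have hR : ∑ b ∈ nbr, F * ∑ n : B → Fin N, (if (∀ x', siteDeg l n x' = 0 ∨ siteDeg l n x' = N) then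
        (4 * ((n b : ℕ) : ℂ) * ((N : ℂ) + 1 - (n b : ℕ))) * zWeight N l Γ n else 0) =
      ∑ n : B → Fin N, ∑ b ∈ nbr, F * (if (∀ x', siteDeg l n x' = 0 ∨ siteDeg l n x' = N) then
        (4 * ((n b : ℕ) : ℂ) * ((N : ℂ) + 1 - (n b : ℕ))) * zWeight N l Γ n else 0) := by
    rw [Finset.sum_comm]
    exact Finset.sum_congr rfl fun b _ => Finset.mul_sum _ _ _
  rw [hL, hR]
  refine Finset.sum_le_sum fun n _ => ?_
  by_cases hadm : ∀ x', siteDeg l n x' = 0 ∨ siteDeg l n x' = N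
  · have hsum : ∑ b ∈ nbr, F * (if (∀ x', siteDeg l n x' = 0 ∨ siteDeg l n x' = N) then
          (4 * ((n b : ℕ) : ℂ) * ((N : ℂ) + 1 - (n b : ℕ))) * zWeight N l Γ n else 0) =
        (∑ b ∈ nbr, 4 * ((n b : ℕ) : ℂ) * ((N : ℂ) + 1 - (n b : ℕ))) * (F * zWeight N l Γ n) := by
      rw [Finset.sum_mul]
      exact Finset.sum_congr rfl fun b _ => by rw [if_pos hadm]; ring
    rw [hsum]
    by_cases hx : siteDeg l n x = N
    · rw [if_pos ⟨hadm, hx⟩]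
      refine mul_le_mul_of_nonneg_right ?_ (mul_nonneg hFnn (zWeight_nonneg hN l Γ hΓ n))
      have hdeg : ((N : ℕ) : ℂ) = ∑ b ∈ nbr, ((n b : ℕ) : ℂ) := by
        have h := congrArg (Nat.cast : ℕ → ℂ) hx
        rw [siteDeg_eq_sum_filter l hl n x, Nat.cast_sum] at h
        exact h.symm
      calc 8 * (N : ℂ) = ∑ b ∈ nbr, 8 * ((n b : ℕ) : ℂ) := by rw [← Finset.mul_sum, ← hdeg]
        _ ≤ ∑ b ∈ nbr, 4 * ((n b : ℕ) : ℂ) * ((N : ℂ) + 1 - (n b : ℕ)) := Finset.sum_le_sum fun b _ => by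
            rw [hcoef, show (8 : ℂ) * ((n b : ℕ) : ℂ) = 4 * ((n b : ℕ) : ℂ) * ((2 : ℕ) : ℂ) by push_cast; ring]
            exact mul_le_mul_of_nonneg_left (Nat.cast_le.2 (by have := (n b).2; omega))
              (mul_nonneg (by norm_num) (Nat.cast_nonneg _))
    · rw [if_neg fun h => hx h.2, mul_zero, mul_zero]
      exact mul_nonneg (Finset.sum_nonneg fun b _ => hfnn n b) (mul_nonneg hFnn (zWeight_nonneg hN l Γ hΓ n))
  · rw [if_neg fun h => hadm h.1, mul_zero, mul_zero]
    exact Finset.sum_nonneg fun b _ => by rw [if_neg hadm, mul_zero]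

/-- **Dimer sites and baryonic sites**: `σ_Λ Z = (N!)^{|Λ|} (∑_{n adm, d_n(x) = N} W(n) + ∑_{n adm, d_n(x) = 0} W(n))`
— in an admissible configuration the site `x` is either saturated by dimers or untouched (then it lies on
a baryon loop or an `N`-fold dimer of the determinant). [cite: FrommForcrand2008, (6)] -/
theorem sgn_mul_fermiZSU_eq_dimer_add_baryonic (hN : Odd N) (l : B → Λ × Λ) (hl : ∀ b, (l b).1 ≠ (l b).2)
    (Γ : B → ℂ) (hΓ : ∀ b, Γ b ^ 2 = 1) (x : Λ) :
    sgn (Fintype.card (CIdx Λ N)) * fermiZSU (N := N) l Γ 0 =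
      (N.factorial : ℂ) ^ Fintype.card Λ *
          ∑ n : B → Fin N, (if (∀ x', siteDeg l n x' = 0 ∨ siteDeg l n x' = N) ∧ siteDeg l n x = N then zWeight N l Γ n else 0) +
        (N.factorial : ℂ) ^ Fintype.card Λ *
          ∑ n : B → Fin N, (if (∀ x', siteDeg l n x' = 0 ∨ siteDeg l n x' = N) ∧ siteDeg l n x = 0 then zWeight N l Γ n else 0) := by
  rw [fermiZSU_eq_sum_det_red hN l hl Γ hΓ, ← mul_assoc, ← mul_assoc, sgn_mul_self, one_mul, ← mul_add, ← Finset.sum_add_distrib]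
  congr 1
  refine Finset.sum_congr rfl fun n _ => ?_
  by_cases hadm : ∀ x', siteDeg l n x' = 0 ∨ siteDeg l n x' = N
  · rcases hadm x with h0 | hN'
    · have hne : ¬siteDeg l n x = N := by rw [h0]; exact Nat.ne_of_lt hN.pos
      rw [if_pos hadm, if_neg fun h => hne h.2, if_pos ⟨hadm, h0⟩, zero_add, zWeight]
    · have hne : ¬siteDeg l n x = 0 := by rw [hN']; exact hN.pos.ne'
      rw [if_pos hadm, if_pos ⟨hadm, hN'⟩, if_neg fun h => hne h.2, add_zero, zWeight]
  · rw [if_neg hadm, if_neg fun h => hadm h.1, if_neg fun h => hadm h.1, add_zero]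

open scoped ComplexOrder in
/-- **THE SCHWINGER–DYSON BOUND, BARYONIC FORM**: for odd `N`, `Γ_b = ±1`, every site `x`,
`8N (σ_Λ Z - (N!)^{|Λ|} ∑_{n adm, x untouched} W(n)) ≤ ∑_{b ∋ x} σ_Λ ∫ e^{-S_F} ψ̄ψ(x_b)ψ̄ψ(y_b)`: the
Salmhofer–Seiler bound `∑_{y∼x}⟨ψ̄ψ(x)ψ̄ψ(y)⟩ ≥ 8N` holds up to `8N` times the weight of the configurations in
which `x` is a baryonic site — the term an extension of SS91 Thm 4.8 to `SU(N)` has to control. [cite: SalmhoferSeiler1991, §3 (3.44)–(3.46), Lemma 4.7 (4.38) & §5 p. 424] [cite: FrommForcrand2008, (6)] -/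
theorem sd_site_lower_bound_baryonic (hN : Odd N) (l : B → Λ × Λ) (hl : ∀ b, (l b).1 ≠ (l b).2) (Γ : B → ℂ)
    (hΓ : ∀ b, Γ b = 1 ∨ Γ b = -1) (x : Λ) :
    8 * (N : ℂ) * (sgn (Fintype.card (CIdx Λ N)) * fermiZSU (N := N) l Γ 0 -
        (N.factorial : ℂ) ^ Fintype.card Λ *
          ∑ n : B → Fin N, (if (∀ x', siteDeg l n x' = 0 ∨ siteDeg l n x' = N) ∧ siteDeg l n x = 0 then zWeight N l Γ n else 0)) ≤
      ∑ b ∈ Finset.univ.filter (fun b => (l b).1 = x ∨ (l b).2 = x),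
        sgn (Fintype.card (CIdx Λ N)) * fermiBracketSU l Γ 0 (fun _ => (meson (l b).1 * meson (l b).2 : FermiAlg Λ N)) := by
  have hΓ2 : ∀ b, Γ b ^ 2 = 1 := fun b => by rcases hΓ b with h | h <;> simp [h]
  rw [sgn_mul_fermiZSU_eq_dimer_add_baryonic hN l hl Γ hΓ2 x, add_sub_cancel_right]
  exact sd_site_lower_bound hN l hl Γ hΓ x

end SchwingerDyson

/-! ### Stage B11: the cycle expansion of the baryon determinant through an untouched site -/

section BaryonCycles

variable {Λ : Type*} [LinearOrder Λ] [Fintype Λ] {N : ℕ}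
variable {B : Type*} [Fintype B] [DecidableEq B]

omit [Fintype Λ] [DecidableEq B] in
/-- **For odd `N` the reduced hopping matrix is alternating** (over `ℂ`, any signs): `K̃ᵀ = -K̃`. [cite: FrommForcrand2008, (5)] -/
theorem Kred_transpose (hN : Odd N) (l : B → Λ × Λ) (Γ : B → ℂ) (D : Λ → ℕ) :
    (Kred N l Γ D)ᵀ = -Kred N l Γ D := by
  ext u v
  simp only [Matrix.transpose_apply, Matrix.neg_apply, Kred, ← Finset.sum_neg_distrib, hN.neg_pow]
  exact Finset.sum_congr rfl fun b _ => by split_ifs <;> ring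

omit [Fintype Λ] [DecidableEq B] in
/-- For odd `N` the reduced hopping matrix has zero diagonal (a link with coincident endpoints would
contribute `(-Γ/2)^N + (Γ/2)^N = 0`). [cite: FrommForcrand2008, (5)] -/
theorem Kred_diag (hN : Odd N) (l : B → Λ × Λ) (Γ : B → ℂ) (D : Λ → ℕ) (u : Free D) : Kred N l Γ D u u = 0 := by
  rw [Kred]
  exact Finset.sum_eq_zero fun b _ => by rw [hN.neg_pow]; split_ifs <;> ring

omit [Fintype Λ] [DecidableEq B] in
/-- Non-adjacent untouched sites do not hop: `K̃_{uv} = 0` unless some link joins `u` and `v`. [cite: FrommForcrand2008, (5)] -/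
theorem Kred_apply_eq_zero_of_not_adj (l : B → Λ × Λ) (Γ : B → ℂ) (D : Λ → ℕ) (u v : Free D)
    (h : ∀ b, ¬((l b).1 = u.1 ∧ (l b).2 = v.1) ∧ ¬((l b).1 = v.1 ∧ (l b).2 = u.1)) : Kred N l Γ D u v = 0 := by
  rw [Kred]
  exact Finset.sum_eq_zero fun b _ => by rw [if_neg (h b).1, if_neg (h b).2, add_zero]

omit [DecidableEq B] in
/-- **THE BARYON DETERMINANT EXPANDED ALONG THE CYCLES THROUGH AN UNTOUCHED SITE** (`N` odd):
`det K̃_S = ∑_{z cyclic through v} sgn z (∏_{i ∈ supp z} K̃_{z(i) i}) det K̃[S ∖ supp z]` — the oriented baryon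
loops through `v` of Fromm–de Forcrand (6) (2-cycles = the `N`-fold dimers at `v`), each times the baryon
determinant of the remaining untouched sites (`Literature.LinearAlgebra.Matrix.det_eq_sum_cycle_of_diag_eq_zero`). [cite: FrommForcrand2008, (6)] [cite: CvetkovicDoobSachs1980, §1.4 Thm 1.2 & (1.35*)] -/
theorem det_Kred_eq_sum_cycle (hN : Odd N) (l : B → Λ × Λ) (Γ : B → ℂ) (D : Λ → ℕ) (v : Free D) :
    (Kred N l Γ D).det =
      ∑ z ∈ Finset.univ.filter (fun z : Equiv.Perm (Free D) => z.cycleOf v = z ∧ z v ≠ v),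
        ((Equiv.Perm.sign z : ℤ) : ℂ) * (∏ i ∈ z.support, Kred N l Γ D (z i) i) *
          ((Kred N l Γ D).submatrix (Subtype.val : {u // u ∉ z.support} → Free D) Subtype.val).det :=
  Literature.LinearAlgebra.Matrix.det_eq_sum_cycle_of_diag_eq_zero _ (Kred_diag hN l Γ D) v

/-! #### The `2`-cycles: `N`-fold dimers between neighbouring untouched sites -/

omit [Fintype B] [DecidableEq B] in
/-- A transposition through `v` is its own cycle through `v`. [cite: Biggs1974, Proposition 7.2] -/
theorem swap_mem_cycles {D : Λ → ℕ} {v u : Free D} (h : v ≠ u) :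
    (Equiv.swap v u).cycleOf v = Equiv.swap v u ∧ (Equiv.swap v u) v ≠ v := by
  have hv : (Equiv.swap v u) v ≠ v := by rw [Equiv.swap_apply_left]; exact h.symm
  exact ⟨(Equiv.Perm.isCycle_swap h).cycleOf_eq hv, hv⟩

omit [DecidableEq B] in
/-- The weight of the `2`-cycle `(v u)` in the cycle expansion: `sgn · ∏ = -K̃_{uv} K̃_{vu}`. [cite: FrommForcrand2008, (6)] -/
theorem sign_mul_prod_swap (l : B → Λ × Λ) (Γ : B → ℂ) {D : Λ → ℕ} {v u : Free D} (h : v ≠ u) :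
    ((Equiv.Perm.sign (Equiv.swap v u) : ℤ) : ℂ) * ∏ i ∈ (Equiv.swap v u).support, Kred N l Γ D (Equiv.swap v u i) i =
      -(Kred N l Γ D u v * Kred N l Γ D v u) := by
  rw [Equiv.Perm.sign_swap h, Equiv.Perm.support_swap h, Finset.prod_pair h, Equiv.swap_apply_left,
    Equiv.swap_apply_right, Units.val_neg, Units.val_one, Int.cast_neg, Int.cast_one, neg_one_mul]

omit [Fintype Λ] [Fintype B] [DecidableEq B] in
/-- **The `N`-fold dimer coefficient**: if exactly one link `b` joins the untouched sites `u ≠ v` and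
`Γ_b = ±1`, `N` odd, then `K̃_{uv} K̃_{vu} = -4^{-N}` (`= κ_b κ'_b / ε_N²`: the product of the two hops). [cite: FrommForcrand2008, (5)–(6)] -/
theorem Kred_mul_Kred_of_unique_link [Fintype B] (hN : Odd N) (l : B → Λ × Λ) (Γ : B → ℂ) {D : Λ → ℕ} {u v : Free D}
    (huv : u.1 ≠ v.1) (b : B) (hb : ((l b).1 = u.1 ∧ (l b).2 = v.1) ∨ ((l b).1 = v.1 ∧ (l b).2 = u.1))
    (huniq : ∀ b', (((l b').1 = u.1 ∧ (l b').2 = v.1) ∨ ((l b').1 = v.1 ∧ (l b').2 = u.1)) → b' = b)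
    (hΓ : Γ b = 1 ∨ Γ b = -1) :
    Kred N l Γ D u v * Kred N l Γ D v u = -((4 : ℂ)⁻¹) ^ N := by
  have hΓ2 : Γ b ^ 2 = 1 := by rcases hΓ with h | h <;> simp [h]
  have hsingle : ∀ (p q : Free D), (p = u ∧ q = v) ∨ (p = v ∧ q = u) →
      Kred N l Γ D p q = (if (l b).1 = p.1 ∧ (l b).2 = q.1 then (-(Γ b / 2)) ^ N else 0) +
        (if (l b).1 = q.1 ∧ (l b).2 = p.1 then (Γ b / 2) ^ N else 0) := by
    intro p q hpq
    rw [Kred]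
    refine Finset.sum_eq_single b (fun b' _ hb' => ?_) (fun h => absurd (Finset.mem_univ b) h)
    have hnot : ¬(((l b').1 = u.1 ∧ (l b').2 = v.1) ∨ ((l b').1 = v.1 ∧ (l b').2 = u.1)) := fun h => hb' (huniq b' h)
    rcases hpq with ⟨rfl, rfl⟩ | ⟨rfl, rfl⟩
    · rw [if_neg fun h => hnot (Or.inl h), if_neg fun h => hnot (Or.inr h), add_zero]
    · rw [if_neg fun h => hnot (Or.inr h), if_neg fun h => hnot (Or.inl h), add_zero]
  rw [hsingle u v (Or.inl ⟨rfl, rfl⟩), hsingle v u (Or.inr ⟨rfl, rfl⟩)]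
  have hpow : (-(Γ b / 2)) ^ N * (Γ b / 2) ^ N = -((4 : ℂ)⁻¹) ^ N := by
    rw [hN.neg_pow, neg_mul, ← mul_pow, show Γ b / 2 * (Γ b / 2) = Γ b ^ 2 / 4 by ring, hΓ2, one_div]
  rcases hb with ⟨h1, h2⟩ | ⟨h1, h2⟩
  · have hno : ¬((l b).1 = v.1 ∧ (l b).2 = u.1) := fun h => huv (h1.symm.trans h.1)
    rw [if_pos ⟨h1, h2⟩, if_neg hno, if_neg hno, if_pos ⟨h1, h2⟩, add_zero, zero_add, hpow]
  · have hno : ¬((l b).1 = u.1 ∧ (l b).2 = v.1) := fun h => huv (h.1.symm.trans h1)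
    rw [if_neg hno, if_pos ⟨h1, h2⟩, if_pos ⟨h1, h2⟩, if_neg hno, add_zero, zero_add, mul_comm, hpow]

omit [Fintype B] [DecidableEq B] in
/-- **The `2`-cycle term of the baryon determinant is the `N`-fold dimer weight**: for neighbouring
untouched sites `v ≠ u` joined by exactly one link with `Γ_b = ±1` (`N` odd), the term `z = (v u)` of
`det_Kred_eq_sum_cycle` equals `4^{-N} det K̃[S ∖ {v,u}] ≥ 0`. [cite: FrommForcrand2008, (5)–(6)] -/
theorem swap_term_eq [Fintype B] (hN : Odd N) (l : B → Λ × Λ) (Γ : B → ℂ) {D : Λ → ℕ} {v u : Free D} (h : v ≠ u)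
    (b : B) (hb : ((l b).1 = u.1 ∧ (l b).2 = v.1) ∨ ((l b).1 = v.1 ∧ (l b).2 = u.1))
    (huniq : ∀ b', (((l b').1 = u.1 ∧ (l b').2 = v.1) ∨ ((l b').1 = v.1 ∧ (l b').2 = u.1)) → b' = b)
    (hΓ : Γ b = 1 ∨ Γ b = -1) :
    ((Equiv.Perm.sign (Equiv.swap v u) : ℤ) : ℂ) * (∏ i ∈ (Equiv.swap v u).support, Kred N l Γ D (Equiv.swap v u i) i) *
        ((Kred N l Γ D).submatrix (Subtype.val : {w // w ∉ (Equiv.swap v u).support} → Free D) Subtype.val).det =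
      ((4 : ℂ)⁻¹) ^ N *
        ((Kred N l Γ D).submatrix (Subtype.val : {w // w ∉ (Equiv.swap v u).support} → Free D) Subtype.val).det := by
  have huv : u.1 ≠ v.1 := fun h' => h (Subtype.ext h'.symm)
  rw [sign_mul_prod_swap l Γ h, Kred_mul_Kred_of_unique_link hN l Γ huv b hb huniq hΓ, neg_neg]

/-! #### The complementary minor of a `2`-cycle is the baryon determinant of a degree pattern -/

omit [Fintype Λ] [Fintype B] [DecidableEq B] in
/-- Saturating the endpoints of `b`: the pattern `D + N·([· = x_b] + [· = y_b])` vanishes exactly at the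
untouched sites other than `x_b, y_b` (`N ≥ 1`). [cite: FrommForcrand2008, (6)] -/
theorem saturate_eq_zero_iff (hN : 0 < N) (l : B → Λ × Λ) (b : B) (D : Λ → ℕ) (x : Λ) :
    D x + N * bondObs l b x = 0 ↔ D x = 0 ∧ (l b).1 ≠ x ∧ (l b).2 ≠ x := by
  unfold bondObs
  constructor
  · intro h
    have hD : D x = 0 := by omega
    have hb0 : bondObs l b x = 0 := by
      unfold bondObs
      rcases Nat.eq_zero_or_pos ((if (l b).1 = x then 1 else 0) + (if (l b).2 = x then 1 else 0)) with h0 | hpos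
      · exact h0
      · exfalso
        have := Nat.mul_pos hN hpos
        omega
    unfold bondObs at hb0
    refine ⟨hD, fun h1 => ?_, fun h2 => ?_⟩
    · rw [if_pos h1] at hb0; omega
    · rw [if_pos h2] at hb0; omega
  · rintro ⟨hD, h1, h2⟩
    simp [hD, h1, h2]

/-- The untouched sites of the saturated pattern, as the untouched sites of `D` off the transposition
`(x_b y_b)`. [cite: FrommForcrand2008, (6)] -/
def freeSaturateEquiv (hN : 0 < N) (l : B → Λ × Λ) (b : B) (D : Λ → ℕ) (v u : Free D)
    (hv : v.1 = (l b).1) (hu : u.1 = (l b).2) (h : v ≠ u) :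
    Free (fun x => D x + N * bondObs l b x) ≃ {w : Free D // w ∉ (Equiv.swap v u).support} where
  toFun p := ⟨⟨p.1, ((saturate_eq_zero_iff hN l b D p.1).1 p.2).1⟩, by
    rw [Equiv.Perm.support_swap h, Finset.mem_insert, Finset.mem_singleton, not_or]
    obtain ⟨-, h1, h2⟩ := (saturate_eq_zero_iff hN l b D p.1).1 p.2
    exact ⟨fun hp => h1 (hv ▸ (congrArg Subtype.val hp).symm), fun hp => h2 (hu ▸ (congrArg Subtype.val hp).symm)⟩⟩
  invFun w := ⟨w.1.1, (saturate_eq_zero_iff hN l b D w.1.1).2 (by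
    have hv' : w.1 ≠ v := fun he => w.2 (Equiv.Perm.mem_support.2 (by
      rw [he, Equiv.swap_apply_left]; exact h.symm))
    have hu' : w.1 ≠ u := fun he => w.2 (Equiv.Perm.mem_support.2 (by
      rw [he, Equiv.swap_apply_right]; exact h))
    exact ⟨w.1.2, fun h1 => hv' (Subtype.ext (hv.trans h1).symm), fun h2 => hu' (Subtype.ext (hu.trans h2).symm)⟩)⟩
  left_inv p := Subtype.ext rfl
  right_inv w := Subtype.ext (Subtype.ext rfl)

omit [DecidableEq B] in
/-- **The complementary minor of the `2`-cycle `(x_b y_b)` is the baryon determinant of the pattern with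
`x_b, y_b` saturated**: `det K̃[S ∖ {x_b, y_b}] = det K̃_{S'}`, `S' = S(D + N·1_{x_b,y_b})`. [cite: FrommForcrand2008, (6)] -/
theorem det_submatrix_swap_eq (hN : 0 < N) (l : B → Λ × Λ) (Γ : B → ℂ) (b : B) (D : Λ → ℕ) (v u : Free D)
    (hv : v.1 = (l b).1) (hu : u.1 = (l b).2) (h : v ≠ u) :
    ((Kred N l Γ D).submatrix (Subtype.val : {w // w ∉ (Equiv.swap v u).support} → Free D) Subtype.val).det =
      (Kred N l Γ (fun x => D x + N * bondObs l b x)).det := by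
  rw [← Matrix.det_submatrix_equiv_self (freeSaturateEquiv hN l b D v u hv hu h)]
  congr 1

omit [Fintype B] [DecidableEq B] in
/-- Saturating the two endpoints removes exactly two untouched sites: `|S'| + 2 = |S|`. [cite: FrommForcrand2008, (6)] -/
theorem card_free_saturate (hN : 0 < N) (l : B → Λ × Λ) (b : B) (D : Λ → ℕ) (v u : Free D)
    (hv : v.1 = (l b).1) (hu : u.1 = (l b).2) (h : v ≠ u) :
    Fintype.card (Free (fun x => D x + N * bondObs l b x)) + 2 = Fintype.card (Free D) := by
  have h2 : 2 ≤ Fintype.card (Free D) := by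
    rw [← Equiv.Perm.card_support_swap h]; exact Finset.card_le_univ _
  rw [Fintype.card_congr (freeSaturateEquiv hN l b D v u hv hu h), Fintype.card_subtype_compl, Fintype.card_coe,
    Equiv.Perm.card_support_swap h]
  omega

/-- **The top dimer coefficient**: `c_{N-1} (N!)² = 4^{1-N} N` (`N ≥ 1`), i.e. `α_{N-1} = 1/(N!(N-1)!)` — the
constant by which the `N`-fold-dimer terms of the two-point function are `4N` times the `2`-cycle terms
of `Z`. [cite: FrommForcrand2008, (5)] -/
theorem dimerCoeff_pred_mul_factorial_sq (hN : 0 < N) :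
    dimerCoeff N (N - 1) * (N.factorial : ℂ) ^ 2 = 4 * (N : ℂ) * ((4 : ℂ)⁻¹) ^ N := by
  obtain ⟨M, rfl⟩ : ∃ M, N = M + 1 := ⟨N - 1, by omega⟩
  rw [dimerCoeff, Nat.add_sub_cancel, show M + 1 - M = 1 by omega, Nat.factorial_one, Nat.cast_one, Nat.factorial_succ,
    pow_succ, pow_succ]
  have hf : ((M.factorial : ℂ)) ≠ 0 := Nat.cast_ne_zero.2 (Nat.factorial_ne_zero M)
  have hM : ((M : ℂ) + 1) ≠ 0 := by exact_mod_cast Nat.succ_ne_zero M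
  push_cast
  field_simp
  ring

end BaryonCycles

/-! ### Stage B12: the `N`-fold-dimer terms of the two-point function vs. the saturated-pair terms of `Z` -/

section TopDimer

variable {Λ : Type*} [LinearOrder Λ] [Fintype Λ] {N : ℕ}
variable {B : Type*} [Fintype B] [DecidableEq B]

omit [Fintype Λ] [Fintype B] [DecidableEq B] in
/-- The bond pattern at the first endpoint (distinct endpoints). [cite: FrommForcrand2008, (6)] -/
theorem bondObs_fst (l : B → Λ × Λ) (b : B) (hxy : (l b).1 ≠ (l b).2) : bondObs l b (l b).1 = 1 := by
  unfold bondObs; rw [if_pos rfl, if_neg (Ne.symm hxy)]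

omit [Fintype Λ] [Fintype B] [DecidableEq B] in
/-- The bond pattern at the second endpoint (distinct endpoints). [cite: FrommForcrand2008, (6)] -/
theorem bondObs_snd (l : B → Λ × Λ) (b : B) (hxy : (l b).1 ≠ (l b).2) : bondObs l b (l b).2 = 1 := by
  unfold bondObs; rw [if_neg hxy, if_pos rfl]

omit [Fintype Λ] [Fintype B] [DecidableEq B] in
/-- The bond pattern vanishes off the endpoints. [cite: FrommForcrand2008, (6)] -/
theorem bondObs_of_ne (l : B → Λ × Λ) (b : B) {x : Λ} (h1 : (l b).1 ≠ x) (h2 : (l b).2 ≠ x) : bondObs l b x = 0 := by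
  unfold bondObs; rw [if_neg h1, if_neg h2]

omit [Fintype Λ] in
/-- Re-setting the dimer number of one bond from `0` to `j` adds `j` times the bond pattern to the site
degrees. [cite: FrommForcrand2008, (6)] -/
theorem siteDeg_update_of_eq_zero (l : B → Λ × Λ) (n : B → Fin N) (b : B) (h0 : (n b : ℕ) = 0) (j : Fin N) (x : Λ) :
    siteDeg l (Function.update n b j) x = siteDeg l n x + (j : ℕ) * bondObs l b x := by
  have key : ∀ (p : B → Prop) [DecidablePred p],
      ∑ b' ∈ Finset.univ.filter p, ((Function.update n b j b' : Fin N) : ℕ) =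
        (∑ b' ∈ Finset.univ.filter p, (n b' : ℕ)) + (if p b then (j : ℕ) else 0) := by
    intro p _
    by_cases hp : p b
    · have hmem : b ∈ Finset.univ.filter p := Finset.mem_filter.2 ⟨Finset.mem_univ _, hp⟩
      rw [← Finset.add_sum_erase _ _ hmem, ← Finset.add_sum_erase _ _ hmem, if_pos hp, Function.update_self, h0,
        Finset.sum_congr rfl fun b' hb' => by
          rw [Function.update_of_ne (show b' ≠ b from Finset.ne_of_mem_erase hb')]]
      ring
    · rw [if_neg hp, add_zero]
      exact Finset.sum_congr rfl fun b' hb' => by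
        rw [Function.update_of_ne (show b' ≠ b from fun hb => hp (by rw [← hb]; exact (Finset.mem_filter.1 hb').2))]
  rw [siteDeg, siteDeg, key (fun b' => (l b').1 = x), key (fun b' => (l b').2 = x), bondObs]
  simp only [mul_add, mul_ite, mul_one, mul_zero]
  ring

omit [Fintype Λ] in
/-- As degree patterns: `d_{n[b ↦ j]} = d_n + j·e_b` when `n_b = 0`. [cite: FrommForcrand2008, (6)] -/
theorem siteDeg_update_eq (l : B → Λ × Λ) (n : B → Fin N) (b : B) (h0 : (n b : ℕ) = 0) (j : Fin N) :
    siteDeg l (Function.update n b j) = fun x => siteDeg l n x + (j : ℕ) * bondObs l b x :=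
  funext fun x => siteDeg_update_of_eq_zero l n b h0 j x

omit [LinearOrder Λ] [Fintype Λ] in
/-- The weight after re-setting one bond from `0` to `j`: `w(n[b ↦ j]) = c_j · w(n)`. [cite: FrommForcrand2008, (5)–(6)] -/
theorem prod_dimerCoeff_update_of_eq_zero (n : B → Fin N) (b : B) (h0 : (n b : ℕ) = 0) (j : Fin N) :
    ∏ b', dimerCoeff N (Function.update n b j b' : ℕ) = dimerCoeff N j * ∏ b', dimerCoeff N (n b' : ℕ) := by
  rw [← Finset.mul_prod_erase Finset.univ (fun b' => dimerCoeff N (Function.update n b j b' : ℕ)) (Finset.mem_univ b),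
    ← Finset.mul_prod_erase Finset.univ (fun b' => dimerCoeff N (n b' : ℕ)) (Finset.mem_univ b),
    Function.update_self, h0, dimerCoeff_zero, one_mul,
    Finset.prod_congr rfl fun b' hb' => by
      rw [Function.update_of_ne (show b' ≠ b from Finset.ne_of_mem_erase hb')]]

omit [Fintype Λ] [Fintype B] [DecidableEq B] in
/-- **Admissibility of the pattern with the endpoints of `b` saturated** (distinct endpoints, `N ≥ 1`):
`D + N·e_b ∈ {0,N}^Λ ↔ D ∈ {0,N}^Λ ∧ D(x_b) = D(y_b) = 0`. [cite: FrommForcrand2008, (6)] -/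
theorem adm_saturate_iff (hN : 0 < N) (l : B → Λ × Λ) (b : B) (hxy : (l b).1 ≠ (l b).2) (D : Λ → ℕ) :
    (∀ x, D x + N * bondObs l b x = 0 ∨ D x + N * bondObs l b x = N) ↔
      (∀ x, D x = 0 ∨ D x = N) ∧ D (l b).1 = 0 ∧ D (l b).2 = 0 := by
  constructor
  · intro h
    have h1 : D (l b).1 = 0 := by have := h (l b).1; rw [bondObs_fst l b hxy] at this; omega
    have h2 : D (l b).2 = 0 := by have := h (l b).2; rw [bondObs_snd l b hxy] at this; omega
    refine ⟨fun x => ?_, h1, h2⟩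
    by_cases hx1 : (l b).1 = x
    · exact Or.inl (hx1 ▸ h1)
    · by_cases hx2 : (l b).2 = x
      · exact Or.inl (hx2 ▸ h2)
      · have := h x; rw [bondObs_of_ne l b hx1 hx2, mul_zero, add_zero] at this; exact this
  · rintro ⟨hadm, h1, h2⟩ x
    by_cases hx1 : (l b).1 = x
    · subst hx1; rw [bondObs_fst l b hxy, h1]; right; ring
    · by_cases hx2 : (l b).2 = x
      · subst hx2; rw [bondObs_snd l b hxy, h2]; right; ring
      · rw [bondObs_of_ne l b hx1 hx2, mul_zero, add_zero]; exact hadm x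

/-- Exchanging the dimer numbers `0 ↔ N-1` on one bond (an involution of the configurations). [cite: FrommForcrand2008, (6)] -/
def flipBond (hN : 0 < N) (b : B) (n : B → Fin N) : B → Fin N :=
  Function.update n b (Equiv.swap (⟨0, hN⟩ : Fin N) ⟨N - 1, by omega⟩ (n b))

omit [Fintype B] in
/-- `flipBond` is an involution. [cite: FrommForcrand2008, (6)] -/
theorem flipBond_involutive (hN : 0 < N) (b : B) : Function.Involutive (flipBond (B := B) hN b) := by
  intro n
  unfold flipBond
  rw [Function.update_self, Equiv.swap_apply_self, Function.update_idem, Function.update_eq_self]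

omit [Fintype B] in
/-- The flipped bond value. [cite: FrommForcrand2008, (6)] -/
theorem flipBond_apply_self (hN : 0 < N) (b : B) (n : B → Fin N) :
    flipBond hN b n b = Equiv.swap (⟨0, hN⟩ : Fin N) ⟨N - 1, by omega⟩ (n b) := by
  rw [flipBond, Function.update_self]

omit [Fintype B] in
/-- On a configuration with `n_b = 0`, `flipBond` sets the bond to `N - 1`. [cite: FrommForcrand2008, (6)] -/
theorem flipBond_of_eq_zero (hN : 0 < N) (b : B) (n : B → Fin N) (h0 : (n b : ℕ) = 0) :
    flipBond hN b n = Function.update n b ⟨N - 1, by omega⟩ := by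
  have hn : n b = ⟨0, hN⟩ := Fin.ext h0
  rw [flipBond, hn, Equiv.swap_apply_left]

/-- **THE `N`-FOLD-DIMER TERMS OF THE TWO-POINT FUNCTION ARE `4N` TIMES THE SATURATED-PAIR TERMS OF
`Z`** (per bond `b`, distinct endpoints, `N ≥ 1`): the configurations of `∫ψ̄ψ(x_b)ψ̄ψ(y_b)e^{-S_F}`
with `n_b = N-1` (weight `c_{N-1} w`, pattern `d + e_b`, two fewer untouched sites) correspond under
`n_b : N-1 ↦ 0` to the `Z`-configurations with `x_b, y_b` untouched, the baryon determinant being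
`4^{-N}·det K̃` of the pattern with `x_b, y_b` saturated — i.e. to `4N ×` the `2`-cycle `(x_b y_b)` terms
of `det_Kred_eq_sum_cycle` (`swap_term_eq`, `det_submatrix_swap_eq`; `a_{N-1}/(4a_N) = N` of the
monomer–dimer bookkeeping). [cite: FrommForcrand2008, (5)–(6)] [cite: SalmhoferSeiler1991, §3 (3.44)–(3.46) & Lemma 4.7 (4.38)] -/
theorem topDimer_sum_eq (hN : 0 < N) (l : B → Λ × Λ) (hl : ∀ b, (l b).1 ≠ (l b).2) (Γ : B → ℂ) (b : B) :
    ∑ n' : B → Fin N, (if (n' b : ℕ) = N - 1 ∧ (∀ x, (siteDeg l n' + bondObs l b) x = 0 ∨ (siteDeg l n' + bondObs l b) x = N) then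
        (∏ b', dimerCoeff N (n' b')) *
          ((N.factorial : ℂ)⁻¹ ^ Fintype.card (Free (siteDeg l n' + bondObs l b)) *
            (Kred N l Γ (siteDeg l n' + bondObs l b)).det) else 0) =
      4 * (N : ℂ) * ((4 : ℂ)⁻¹) ^ N *
        ∑ n : B → Fin N, (if (n b : ℕ) = 0 ∧ ((∀ x, siteDeg l n x = 0 ∨ siteDeg l n x = N) ∧
            siteDeg l n (l b).1 = 0 ∧ siteDeg l n (l b).2 = 0) then
          (∏ b', dimerCoeff N (n b')) *
            ((N.factorial : ℂ)⁻¹ ^ Fintype.card (Free (siteDeg l n)) *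
              (Kred N l Γ (fun x => siteDeg l n x + N * bondObs l b x)).det) else 0) := by
  set σ := (flipBond_involutive (B := B) hN b).toPerm _ with hσ
  rw [Finset.mul_sum]
  refine Fintype.sum_equiv σ.symm _ _ fun n' => ?_
  -- write `n' = flipBond n` with `n := σ.symm n'`
  set n := σ.symm n' with hn
  have hn' : n' = flipBond hN b n := by
    rw [hn, show flipBond hN b (σ.symm n') = σ (σ.symm n') from rfl, Equiv.apply_symm_apply]
  rw [hn']
  have hF : ((N.factorial : ℂ)) ≠ 0 := Nat.cast_ne_zero.2 (Nat.factorial_ne_zero N)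
  by_cases h0 : (n b : ℕ) = 0
  · -- the bond is empty in `n`: `flipBond` fills it with `N - 1` dimers
    have hflip := flipBond_of_eq_zero hN b n h0
    have htop : ((flipBond hN b n b : Fin N) : ℕ) = N - 1 := by rw [hflip, Function.update_self]
    have hpat : siteDeg l (flipBond hN b n) + bondObs l b = fun x => siteDeg l n x + N * bondObs l b x := by
      rw [hflip, siteDeg_update_eq l n b h0]
      funext x
      simp only [Pi.add_apply]
      rw [add_assoc, ← Nat.succ_mul, Nat.succ_eq_add_one, Nat.sub_add_cancel hN]
    have hw : ∏ b', dimerCoeff N (flipBond hN b n b' : ℕ) = dimerCoeff N (N - 1) * ∏ b', dimerCoeff N (n b' : ℕ) := by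
      rw [hflip, prod_dimerCoeff_update_of_eq_zero n b h0]
    rw [hpat, hw]
    by_cases hc : (∀ x, siteDeg l n x = 0 ∨ siteDeg l n x = N) ∧ siteDeg l n (l b).1 = 0 ∧ siteDeg l n (l b).2 = 0
    · rw [if_pos ⟨htop, (adm_saturate_iff hN l b (hl b) _).2 hc⟩, if_pos ⟨h0, hc⟩]
      have hvu : (⟨(l b).1, hc.2.1⟩ : Free (siteDeg l n)) ≠ ⟨(l b).2, hc.2.2⟩ := fun h => hl b (congrArg Subtype.val h)
      have hcard := card_free_saturate hN l b (siteDeg l n) ⟨(l b).1, hc.2.1⟩ ⟨(l b).2, hc.2.2⟩ rfl rfl hvu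
      rw [← hcard, pow_add]
      have hA : ((N.factorial : ℂ)⁻¹) ^ 2 * (N.factorial : ℂ) ^ 2 = 1 := by
        rw [← mul_pow, inv_mul_cancel₀ hF, one_pow]
      have hc' := dimerCoeff_pred_mul_factorial_sq (N := N) hN
      linear_combination ((∏ b', dimerCoeff N (n b' : ℕ)) *
          ((N.factorial : ℂ)⁻¹ ^ Fintype.card (Free (fun x => siteDeg l n x + N * bondObs l b x))) *
          ((N.factorial : ℂ)⁻¹) ^ 2 * (Kred N l Γ (fun x => siteDeg l n x + N * bondObs l b x)).det) * hc' -
        (dimerCoeff N (N - 1) * (∏ b', dimerCoeff N (n b' : ℕ)) *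
          ((N.factorial : ℂ)⁻¹ ^ Fintype.card (Free (fun x => siteDeg l n x + N * bondObs l b x))) *
          (Kred N l Γ (fun x => siteDeg l n x + N * bondObs l b x)).det) * hA
    · rw [if_neg fun h => hc ((adm_saturate_iff hN l b (hl b) _).1 h.2), if_neg fun h => hc h.2, mul_zero]
  · -- the bond is occupied in `n`: neither side counts it
    have hL : ¬(((flipBond hN b n b : Fin N) : ℕ) = N - 1) := by
      intro hs
      have hs' : flipBond hN b n b = ⟨N - 1, by omega⟩ := Fin.ext hs
      rw [flipBond_apply_self] at hs'
      have : n b = ⟨0, hN⟩ := (Equiv.swap _ _).injective (hs'.trans (Equiv.swap_apply_left _ _).symm)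
      exact h0 (by rw [this])
    rw [if_neg fun h => hL h.1, if_neg fun h => h0 h.1, mul_zero]

/-- **THE EXACT SCHWINGER–DYSON DECOMPOSITION ON ONE BOND** (`N` odd, distinct endpoints, `Γ_b² = 1`):
`σ_Λ ∫ψ̄ψ(x_b)ψ̄ψ(y_b)e^{-S_F} = (N!)^{|Λ|} [∑_{n adm} 4n_b(N+1-n_b) W(n) + ∑_{n' : n'_b = N-1, d_{n'}+e_b adm} w(n')(N!)^{-|S'|} det K̃_{S'}]`
— the two-point configurations with `n_b ≤ N-2` are the `Z`-configurations shifted by one dimer on `b`,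
the others carry the `N`-fold dimer (`sd_bond_lower_bound` is this identity with the second sum
dropped). [cite: FrommForcrand2008, (5)–(6)] [cite: SalmhoferSeiler1991, §3 (3.44)–(3.46) & Lemma 4.7 (4.38)] -/
theorem sd_bond_eq (hN : Odd N) (l : B → Λ × Λ) (hl : ∀ b, (l b).1 ≠ (l b).2) (Γ : B → ℂ)
    (hΓ : ∀ b, Γ b ^ 2 = 1) (b : B) :
    sgn (Fintype.card (CIdx Λ N)) * fermiBracketSU l Γ 0 (fun _ => (meson (l b).1 * meson (l b).2 : FermiAlg Λ N)) =
      (N.factorial : ℂ) ^ Fintype.card Λ *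
        (∑ n : B → Fin N, (if (∀ x, siteDeg l n x = 0 ∨ siteDeg l n x = N) then
            (4 * ((n b : ℕ) : ℂ) * ((N : ℂ) + 1 - (n b : ℕ))) * zWeight N l Γ n else 0) +
          ∑ n' : B → Fin N, (if (n' b : ℕ) = N - 1 ∧
              (∀ x, (siteDeg l n' + bondObs l b) x = 0 ∨ (siteDeg l n' + bondObs l b) x = N) then
            (∏ b', dimerCoeff N (n' b')) *
              ((N.factorial : ℂ)⁻¹ ^ Fintype.card (Free (siteDeg l n' + bondObs l b)) *
                (Kred N l Γ (siteDeg l n' + bondObs l b)).det) else 0)) := by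
  have hobs : (fun _ : B → OneLink.SUN N => (meson (l b).1 * meson (l b).2 : FermiAlg Λ N)) =
      fun _ => (((∏ x, mesonC 1 x ^ bondObs l b x : Subalgebra.center ℂ (FermiAlg Λ N))) : FermiAlg Λ N) :=
    funext fun _ => by rw [prod_mesonC_pow_bondObs, Subalgebra.coe_mul, coe_mesonC, coe_mesonC, one_smul, one_smul]
  rw [hobs, fermiBracketSU_mesonPow_eq_sum_det_red hN l hl Γ hΓ (bondObs l b), ← mul_assoc, ← mul_assoc, sgn_mul_self,
    one_mul]
  congr 1
  set Ψ : (B → Fin N) → ℂ := fun n => if (∀ x, siteDeg l n x = 0 ∨ siteDeg l n x = N) then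
      (4 * ((n b : ℕ) : ℂ) * ((N : ℂ) + 1 - (n b : ℕ))) * zWeight N l Γ n else 0 with hΨ
  set Φ : (B → Fin N) → ℂ := fun n => if (∀ x, (siteDeg l n + bondObs l b) x = 0 ∨ (siteDeg l n + bondObs l b) x = N) then
      (∏ b', dimerCoeff N (n b')) *
        ((N.factorial : ℂ)⁻¹ ^ Fintype.card (Free (siteDeg l n + bondObs l b)) *
          (Kred N l Γ (siteDeg l n + bondObs l b)).det) else 0 with hΦ
  have hΨ0 : ∀ n : B → Fin N, ¬(1 ≤ (n b : ℕ)) → Ψ n = 0 := fun n hnb => by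
    have h0 : (n b : ℕ) = 0 := by omega
    rw [hΨ]; dsimp only
    rw [h0, Nat.cast_zero, mul_zero, zero_mul, zero_mul, ite_self]
  have hshift : ∀ (n : B → Fin N) (h : (n b : ℕ) + 1 < N), Ψ (addDimer n b h) = Φ n := by
    intro n h
    rw [hΨ, hΦ]; dsimp only
    rw [zWeight, siteDeg_addDimer_eq, prod_dimerCoeff_eq_mul_addDimer n b h, addDimer_apply_self]
    split_ifs
    · push_cast; ring
    · rfl
  have hV : ∑ n, Ψ n = ∑ n ∈ Finset.univ.filter (fun n : B → Fin N => (n b : ℕ) + 1 < N), Φ n :=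
    calc ∑ n, Ψ n = ∑ n ∈ Finset.univ.filter (fun n : B → Fin N => 1 ≤ (n b : ℕ)), Ψ n :=
          (Finset.sum_filter_of_ne fun n _ hne => by by_contra hlt; exact hne (hΨ0 n hlt)).symm
      _ = ∑ n ∈ Finset.univ.filter (fun n : B → Fin N => (n b : ℕ) + 1 < N),
            if h : (n b : ℕ) + 1 < N then Ψ (addDimer n b h) else 0 := sum_filter_one_le_eq_sum_addDimer b Ψ
      _ = ∑ n ∈ Finset.univ.filter (fun n : B → Fin N => (n b : ℕ) + 1 < N), Φ n :=
          Finset.sum_congr rfl fun n hn => by rw [dif_pos (Finset.mem_filter.1 hn).2, hshift]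
  have hT : ∑ n ∈ Finset.univ.filter (fun n : B → Fin N => ¬((n b : ℕ) + 1 < N)), Φ n =
      ∑ n' : B → Fin N, (if (n' b : ℕ) = N - 1 ∧
          (∀ x, (siteDeg l n' + bondObs l b) x = 0 ∨ (siteDeg l n' + bondObs l b) x = N) then
        (∏ b', dimerCoeff N (n' b')) *
          ((N.factorial : ℂ)⁻¹ ^ Fintype.card (Free (siteDeg l n' + bondObs l b)) *
            (Kred N l Γ (siteDeg l n' + bondObs l b)).det) else 0) := by
    rw [Finset.sum_filter]
    refine Finset.sum_congr rfl fun n _ => ?_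
    have htop : ¬((n b : ℕ) + 1 < N) ↔ (n b : ℕ) = N - 1 := by have := (n b).2; omega
    by_cases h : (n b : ℕ) = N - 1
    · rw [if_pos (htop.2 h), hΦ]; dsimp only
      by_cases h' : ∀ x, (siteDeg l n + bondObs l b) x = 0 ∨ (siteDeg l n + bondObs l b) x = N
      · rw [if_pos h', if_pos ⟨h, h'⟩]
      · rw [if_neg h', if_neg fun hh => h' hh.2]
    · rw [if_neg fun hh => h (htop.1 hh), if_neg fun hh => h hh.1]
  rw [← Finset.sum_filter_add_sum_filter_not Finset.univ (fun n : B → Fin N => (n b : ℕ) + 1 < N) Φ, hV, hT]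

/-- **THE EXACT SCHWINGER–DYSON DECOMPOSITION, `N`-FOLD DIMERS RESOLVED**: combining `sd_bond_eq` with
`topDimer_sum_eq`,
`σ_Λ ∫ψ̄ψ(x_b)ψ̄ψ(y_b)e^{-S_F} = (N!)^{|Λ|} [∑_{n adm} 4n_b(N+1-n_b) W(n) + 4N·4^{-N} ∑_{n : n_b = 0, adm, x_b,y_b ∈ S(n)} w(n)(N!)^{-|S(n)|} det K̃_{S(n) ∖ {x_b,y_b}}]`
— the second sum runs over the `Z`-configurations in which both endpoints are untouched and carries the
`2`-cycle `(x_b y_b)` of `det_Kred_eq_sum_cycle` with the factor `4N` (`swap_term_eq`,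
`det_submatrix_swap_eq`).  What separates this identity from `∑_{b∋x} ≥ 4N·σ_Λ Z` is exactly the signed
sum of the baryon loops of length `≥ 4` through `x`. [cite: FrommForcrand2008, (5)–(6)] [cite: SalmhoferSeiler1991, §3 (3.44)–(3.46) & Lemma 4.7 (4.38)] -/
theorem sd_bond_eq_topDimer (hN : Odd N) (l : B → Λ × Λ) (hl : ∀ b, (l b).1 ≠ (l b).2) (Γ : B → ℂ)
    (hΓ : ∀ b, Γ b ^ 2 = 1) (b : B) :
    sgn (Fintype.card (CIdx Λ N)) * fermiBracketSU l Γ 0 (fun _ => (meson (l b).1 * meson (l b).2 : FermiAlg Λ N)) =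
      (N.factorial : ℂ) ^ Fintype.card Λ *
        (∑ n : B → Fin N, (if (∀ x, siteDeg l n x = 0 ∨ siteDeg l n x = N) then
            (4 * ((n b : ℕ) : ℂ) * ((N : ℂ) + 1 - (n b : ℕ))) * zWeight N l Γ n else 0) +
          4 * (N : ℂ) * ((4 : ℂ)⁻¹) ^ N *
            ∑ n : B → Fin N, (if (n b : ℕ) = 0 ∧ ((∀ x, siteDeg l n x = 0 ∨ siteDeg l n x = N) ∧
                siteDeg l n (l b).1 = 0 ∧ siteDeg l n (l b).2 = 0) then
              (∏ b', dimerCoeff N (n b')) *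
                ((N.factorial : ℂ)⁻¹ ^ Fintype.card (Free (siteDeg l n)) *
                  (Kred N l Γ (fun x => siteDeg l n x + N * bondObs l b x)).det) else 0)) := by
  rw [sd_bond_eq hN l hl Γ hΓ b, topDimer_sum_eq hN.pos l hl Γ b]

end TopDimer

end StrongCoupling

end Literature.MathematicalPhysics.QuantumLattice
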